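import Literature.Geometry.Lorentzian.KerrDeSitterRadialEnergyIdentity
import Literature.Geometry.Lorentzian.RegularSingularVanishing
import Literature.Analysis.ODE.LinearSecondOrder
import HarnessLib

/-!
# Real-frequency scalar modes on subextremal Kerr–de Sitter: Casals–Teixeira da Costa's
# Theorem 3.10, Step 1, the case `Im ω = 0` (`s = 0`), with the unique continuation it appeals to

Theorems only (no named facts, no new definitions). Companion of
`KerrDeSitterRadialEnergyIdentity.lean`, which proves Step 1 of the printed proof of
[CasalsTeixeiradacosta2022, Theorem 3.10] for `Im ω > 0` (`s = 0`). The printed Step 1 continues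
(arXiv v3 p. 17, display after (3.27) and the paragraph following it):

> "if `Im ω = 0`, `0 = ω(ω−mϖ₁)|u(−∞)|² + ω(ω−mϖ₂)|u(+∞)|²`. … If `ω ∈ ℝ` we cannot argue just from
> [this identity]. As in the Kerr case, we need to appeal to unique continuation for ODEs such as
> (3.9) to deduce that, unless the superradiant condition `m ≠ 0`, `ϖ₂ < ω/m < ϖ₁` holds, we may
> infer that `u ≡ 0`, thus concluding the proof for `s = 0`."

This file proves exactly that, for the `s = 0` radial master equation of
`KerrDeSitterMasterEquations.lean` (CTdC (3.8) with Klein–Gordon switch `μ`; the argument does not see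
`μ`), in the boundary-flux (Wronskian) form used throughout this directory:

* `im_eq_zero_of_angularODE_real`, `masterAngularEigenvalue_real`, `angularEigenvalue_real` — for
  REAL `ν = aω` every angular eigenvalue `λ̄` (resp. `λ`) is real (CTdC §3.2.1, "The case `ν ∈ ℝ` …
  each corresponding to a real value of `λ̄`"): the flux `Im(Im λ̄ · P S' S̄)` is monotone with zero
  limits at both poles.
* `tendsto_boundaryFlux_of_cpowBranch_of_re_eq_zero` — the horizon limit of the flux density of a
  branch `u^z g` with `Re z = 0` is `cz|g(x₀)|²` (the printed boundary values `|u(∓∞)|²`).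
* `eq_zero_near_of_cpowBranch_zero` (and `_left`, by reflection) — UNIQUE CONTINUATION at a regular
  singular endpoint: a branch `(x − x₀)^z f` with `Re z ≥ 0`, `f` smooth and `f(x₀) = 0`, solving
  `ℓ(x)(x − x₀)R'' + D R' + V R = 0`, vanishes near `x₀`, provided the transformed coefficients
  (`ℓP = 2zℓ + D`, `ℓ(x − x₀)Q = ℓ(z² − z) + zD + V(x − x₀)`) extend continuously with
  `Re P(x₀) > 0`. Reduced to the tree's `Kerr.Costa2019.eq_zero_of_regularSingular`
  (`RegularSingularVanishing.lean`, the halving argument used for [Costa2019, Prop. 3.8 (4)]).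
* `masterRadial_eq_zero_of_eventuallyEq_zero` — Grönwall uniqueness along the exterior (any `s`,
  `μ`): a radial solution vanishing near one point of `(r₊, r_c)` vanishes identically
  (`Literature.Analysis.ODE.eqOn_of_solution_Ioo`; `continuousOn_masterRadialPotential`).
* `exists_branchCoeffs` — at a simple zero `p` of `Δ_r`: the exact factorisation
  `Δ_r = (r − p)σ_p(r)` (from `delta_taylor`) and the transformed coefficients `P`, `Q` of the
  `s = 0` equation for an exponent with `z² = −Ξ²K(p)²/Δ_r'(p)²` (`horizonB_sq`); the `1/(r − p)`
  singularity of `Q` cancels by this indicial relation.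
* `masterRadial_zero_eq_zero_of_eventAmplitude_eq_zero`, `…_of_cosmoAmplitude_eq_zero` — an
  ingoing (outgoing) `s = 0` solution whose smooth horizon amplitude vanishes at `r₊` (`r_c`) is
  identically zero, for every `Im ω ≥ 0`.
* `masterRadial_zero_real_eq_zero` — THE THEOREM: `Im ω = 0`, `Im λ̄ = 0`, `(ω, am) ≠ (0, 0)`,
  `(Re ω − mϖ₁)(Re ω − mϖ₂) ≥ 0` (i.e. NOT `ϖ₂ < ω/m < ϖ₁`), ingoing at `𝓗⁺`, outgoing at `𝓗⁺_c`
  `⟹ R ≡ 0` on `(r₊, r_c)`. The coefficient is real (`im_masterRadialPotential_zero_of_real`), so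
  `G = Im(Δ_r R' R̄)` has zero derivative; its horizon limits are `−Ξ Re K(r₊)|f(r₊)|²` and
  `Ξ Re K(r_c)|g(r_c)|²` with `Re K(r_h) = (Re ω − mϖ_h)(r_h² + a²)` (`im_horizonB`, `re_radialK`),
  equal by the Cauchy mean value theorem with endpoint limits; under the sign hypothesis one
  amplitude vanishes, and unique continuation finishes.
* Corollaries: `masterMode_zero_real_superradiant` / `masterMode_zero_real_window` (a non-trivial
  real-frequency solution has `m ≠ 0`, `ϖ₂ < ω/m < ϖ₁`), `noMasterModeIn_zero_realAxis`,
  `not_hasMasterMode_zero_real`, `not_hasMasterMode_zero_real_of_m_zero` (all `μ`; the angular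
  reality discharged), and the Teukolsky `s = 0` forms `noModeIn_zero_realAxis`, `not_hasMode_zero_real`
  (`μ = 1`, via `hasMasterMode_one_iff`).
* The zero frequency for `m ≠ 0`, `a ≠ 0` (appended): `not_hasMasterMode_zero_omega_zero`,
  `noMasterModeIn_zero_omega_zero`, `noMasterModeIn_zero_realAxis_of_m_ne_zero` (the closed real
  axis, `ω = 0` included, for `m ≠ 0`), `not_hasMode_zero_omega_zero` — the same identity read at
  `ω = 0`, where `K = −am ≠ 0` and the sign condition is `m²ϖ₁ϖ₂ ≥ 0`.

What is NOT here: `s ≠ 0` on the real axis (the printed remark points to the Teukolsky–Starobinsky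
identities, [Tachizawa1993] in the source); the sharper interior thresholds of Theorem 3.10's second
bullet (hidden-symmetry Steps 2–3), which remain the named fact
`CasalsTeixeiraDaCosta2022_partialModeStability`; and `ω = 0` with `am = 0` (no flux information —
e.g. the constant solution of `□_g ψ = 0`).

## References
* M. Casals, R. Teixeira da Costa, *Hidden spectral symmetries and mode stability of subextremal
  Kerr(-de Sitter) black holes*, Commun. Math. Phys. 394 (2022) 797–832, arXiv:2105.13329 v3,
  proof of Theorem 3.10, Step 1 (p. 17); §3.2.1 ("The case `ν ∈ ℝ`"). [CasalsTeixeiradacosta2022]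
* Y. Hatsuda, *Quasinormal modes of Kerr–de Sitter black holes via the Heun function*,
  Class. Quantum Grav. 38 (2020) 025015, (2.14), (2.18) (`K`, horizon exponents). [Hatsuda2020]
* R. Teixeira da Costa, Commun. Math. Phys. 378 (2020) 705–781, Prop. 3.8 (4), Lemma 3.14 (the
  regular-singular uniqueness step, `RegularSingularVanishing.lean`). [Costa2019]
-/

noncomputable section

open Complex Set Filter Topology

open scoped ComplexConjugate

namespace Literature.Geometry.Lorentzian.KerrDeSitter

/-! ### Real `ν`: angular eigenvalues are real (CTdC §3.2.1, "The case `ν ∈ ℝ`") -/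

/-- Imaginary part of `c · (P|S'|² − V|S|²)` for REAL `c` and real weight `P` (pure algebra):
`= −c · |S|² · Im V`. [cite: CasalsTeixeiradacosta2022, Lemma 3.1 (proof)] -/
theorem im_ofReal_mul_fluxDeriv (c P : ℝ) (v z z' : ℂ) :
    ((c : ℂ) * ((P : ℂ) * (z' * conj z') - v * (z * conj z))).im = -(c * normSq z * v.im) := by
  rw [Complex.mul_conj, Complex.mul_conj]
  simp only [mul_im, mul_re, sub_im, sub_re, ofReal_re, ofReal_im]
  ring

/-- **The angular flux argument for REAL parameter** (`ν ∈ ℝ`): for the Sturm–Liouville operator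
`d/dx (1+αx²)(1−x²) d/dx + V(x)` on `(−1, 1)`, if `S ≢ 0` is a classical solution regular at both
poles and `Im V(x) = Im λ̄` for every `x` (all other coefficients real), then `Im λ̄ = 0`: the flux
`G = Im(Im λ̄ · P S' S̄)` has `G' = −(Im λ̄)²|S|² ≤ 0`, `< 0` where `S ≠ 0`, while `G → 0` at both poles
(`false_of_antitone_flux`). This is the self-adjointness behind the printed "The case `ν ∈ ℝ`. For
each `ν ∈ ℝ`, there are countably many such solutions … each corresponding to a real value of `λ̄`".
[cite: CasalsTeixeiradacosta2022, Lemma 3.1] -/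
theorem im_eq_zero_of_angularODE_real {α s m : ℝ} {lamBar : ℂ} {V S S' S'' : ℝ → ℂ}
    (hS : ∀ x ∈ Ioo (-1 : ℝ) 1, HasDerivAt S (S' x) x ∧ HasDerivAt S' (S'' x) x ∧
      (((1 + α * x ^ 2) * (1 - x ^ 2) : ℝ) : ℂ) * S'' x +
          ((2 * (α - 1) * x - 4 * α * x ^ 3 : ℝ) : ℂ) * S' x + V x * S x = 0)
    (hreg : IsRegularAtPoles s m S) (hnt : ∃ x ∈ Ioo (-1 : ℝ) 1, S x ≠ 0)
    (hV : ∀ x ∈ Ioo (-1 : ℝ) 1, (V x).im = lamBar.im) :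
    lamBar.im = 0 := by
  by_contra hne
  set c : ℝ := lamBar.im with hc
  have hc2 : 0 < c ^ 2 := by positivity
  obtain ⟨x₀, hx₀D, hSx₀⟩ := hnt
  refine false_of_antitone_flux
    (G := fun x => ((c : ℂ) * ((((1 + α * x ^ 2) * (1 - x ^ 2) : ℝ) : ℂ) * S' x * conj (S x))).im)
    (G' := fun x => ((c : ℂ) * ((((1 + α * x ^ 2) * (1 - x ^ 2) : ℝ) : ℂ) * (S' x * conj (S' x)) -
        V x * (S x * conj (S x)))).im) ?_ ?_ ?_ ?_ ?_
  · -- `G` is differentiable with derivative `G'` (the ODE enters here)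
    intro x hx
    obtain ⟨h1, h2, hode⟩ := hS x hx
    have hPr : HasDerivAt (fun y : ℝ => (1 + α * y ^ 2) * (1 - y ^ 2))
        (2 * (α - 1) * x - 4 * α * x ^ 3) x := by
      have hp : HasDerivAt (fun y : ℝ => y ^ 2) (2 * x) x := by simpa using hasDerivAt_pow 2 x
      exact (((hp.const_mul α).const_add 1).fun_mul (hp.const_sub 1)).congr_deriv (by ring)
    have hSbar : HasDerivAt (fun y => conj (S y)) (conj (S' x)) x := by simpa using h1.star
    have hprod := ((hPr.ofReal_comp.fun_mul h2).fun_mul hSbar).const_mul (c : ℂ)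
    have hF : HasDerivAt
        (fun y => (c : ℂ) * ((((1 + α * y ^ 2) * (1 - y ^ 2) : ℝ) : ℂ) * S' y * conj (S y)))
        ((c : ℂ) * ((((1 + α * x ^ 2) * (1 - x ^ 2) : ℝ) : ℂ) * (S' x * conj (S' x)) -
          V x * (S x * conj (S x)))) x := by
      refine hprod.congr_deriv ?_
      linear_combination ((c : ℂ) * conj (S x)) * hode
    simpa only [Function.comp_def, Complex.imCLM_apply] using
      (Complex.imCLM.hasFDerivAt.comp_hasDerivAt x hF)
  · -- `G' ≤ 0`
    intro x hx
    show ((c : ℂ) * ((((1 + α * x ^ 2) * (1 - x ^ 2) : ℝ) : ℂ) * (S' x * conj (S' x)) -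
        V x * (S x * conj (S x)))).im ≤ 0
    rw [im_ofReal_mul_fluxDeriv, hV x hx]
    have h0 : 0 ≤ normSq (S x) := normSq_nonneg (S x)
    nlinarith
  · -- `G' x₀ < 0`
    refine ⟨x₀, hx₀D, ?_⟩
    show ((c : ℂ) * ((((1 + α * x₀ ^ 2) * (1 - x₀ ^ 2) : ℝ) : ℂ) * (S' x₀ * conj (S' x₀)) -
        V x₀ * (S x₀ * conj (S x₀)))).im < 0
    rw [im_ofReal_mul_fluxDeriv, hV x₀ hx₀D]
    have hpos : 0 < normSq (S x₀) := Complex.normSq_pos.mpr hSx₀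
    nlinarith
  · -- `G → 0` at `x = −1` (regular branch `(1+x)^{|m−s|/2}`)
    obtain ⟨ε, hε, g, hg, hSg⟩ := hreg.1
    have hb : (-1 : ℝ) < min (-1 + ε) 1 := lt_min (by linarith) (by norm_num)
    have hflux := tendsto_boundaryFlux_of_branch (x₀ := -1) (U := Ioo (-1 - ε) (-1 + ε))
      (J := Ioo (-1) (min (-1 + ε) 1)) isOpen_Ioo ⟨by linarith, by linarith⟩ isOpen_Ioo
      (fun x hx => ⟨by linarith [hx.1], lt_of_lt_of_le hx.2 (min_le_left _ _)⟩) hg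
      (u := fun x => 1 + x) (c := 1) (fun x => (hasDerivAt_id' x).const_add 1) (by norm_num)
      (fun x hx => by linarith [hx.1]) (abs_nonneg (m - s))
      (fun x hx => (hS x ⟨hx.1, lt_of_lt_of_le hx.2 (min_le_right _ _)⟩).1)
      (fun x hx => by
        rw [Complex.ofReal_cpow (by linarith [hx.1])]
        exact hSg x ⟨hx.1, lt_of_lt_of_le hx.2 (min_le_left _ _)⟩)
    have hcts : Tendsto (fun x : ℝ => (((1 - x) * (1 + α * x ^ 2) : ℝ) : ℂ)) (𝓝 (-1))
        (𝓝 ((((1 - (-1)) * (1 + α * (-1) ^ 2) : ℝ) : ℂ))) :=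
      (continuous_ofReal.comp (by fun_prop)).tendsto (-1)
    have hlim : Tendsto (fun x => ((c : ℂ) * ((((1 - x) * (1 + α * x ^ 2) : ℝ) : ℂ) *
        (((1 + x : ℝ) : ℂ) * S' x * conj (S x)))).im) (𝓝[Ioo (-1) (min (-1 + ε) 1)] (-1)) (𝓝 0) := by
      have := ((hcts.mono_left nhdsWithin_le_nhds).mul hflux).const_mul (c : ℂ)
      simpa only [Function.comp_def, mul_zero, Complex.zero_im] using
        (Complex.continuous_im.tendsto _).comp this
    rw [nhdsWithin_Ioo_eq_nhdsGT hb] at hlim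
    refine hlim.congr' (Eventually.of_forall fun x => ?_)
    simp only
    congr 1
    push_cast
    ring
  · -- `G → 0` at `x = 1` (regular branch `(1−x)^{|m+s|/2}`)
    obtain ⟨ε, hε, g, hg, hSg⟩ := hreg.2
    have hb : max (1 - ε) (-1) < (1 : ℝ) := max_lt (by linarith) (by norm_num)
    have hflux := tendsto_boundaryFlux_of_branch (x₀ := 1) (U := Ioo (1 - ε) (1 + ε))
      (J := Ioo (max (1 - ε) (-1)) 1) isOpen_Ioo ⟨by linarith, by linarith⟩ isOpen_Ioo
      (fun x hx => ⟨lt_of_le_of_lt (le_max_left _ _) hx.1, by linarith [hx.2]⟩) hg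
      (u := fun x => 1 - x) (c := -1) (fun x => (hasDerivAt_id' x).const_sub 1) (by norm_num)
      (fun x hx => by linarith [hx.2]) (abs_nonneg (m + s))
      (fun x hx => (hS x ⟨lt_of_le_of_lt (le_max_right _ _) hx.1, hx.2⟩).1)
      (fun x hx => by
        rw [Complex.ofReal_cpow (by linarith [hx.2])]
        exact hSg x ⟨lt_of_le_of_lt (le_max_left _ _) hx.1, hx.2⟩)
    have hcts : Tendsto (fun x : ℝ => (((1 + x) * (1 + α * x ^ 2) : ℝ) : ℂ)) (𝓝 1)
        (𝓝 ((((1 + 1) * (1 + α * 1 ^ 2) : ℝ) : ℂ))) :=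
      (continuous_ofReal.comp (by fun_prop)).tendsto 1
    have hlim : Tendsto (fun x => ((c : ℂ) * ((((1 + x) * (1 + α * x ^ 2) : ℝ) : ℂ) *
        (((1 - x : ℝ) : ℂ) * S' x * conj (S x)))).im) (𝓝[Ioo (max (1 - ε) (-1)) 1] 1) (𝓝 0) := by
      have := ((hcts.mono_left nhdsWithin_le_nhds).mul hflux).const_mul (c : ℂ)
      simpa only [Function.comp_def, mul_zero, Complex.zero_im] using
        (Complex.continuous_im.tendsto _).comp this
    rw [nhdsWithin_Ioo_eq_nhdsLT hb] at hlim
    refine hlim.congr' (Eventually.of_forall fun x => ?_)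
    simp only
    congr 1
    push_cast
    ring

/-- The master angular coefficient has `Im V(x) = Im λ̄` when `ν` is real (all other printed
coefficients of (3.6) are real). [cite: CasalsTeixeiradacosta2022, (3.6)] -/
theorem im_masterAngularPotential_of_real (a Λ s μ : ℝ) {ν : ℂ} (hν : ν.im = 0) (m : ℝ)
    (lamBar : ℂ) (x : ℝ) : (masterAngularPotential a Λ s μ ν m lamBar x).im = lamBar.im := by
  have h := congrArg Complex.im (masterAngularPotential_sub a Λ s μ ν m lamBar x)
  simp only [sub_im, add_im, mul_im, ofReal_re, ofReal_im, pow_two, hν, mul_zero, zero_mul,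
    add_zero, sub_zero] at h
  linarith

/-- **Angular eigenvalues are real for real `ν`** (master angular equation (3.6), any `μ`, `s`, `m`):
"The case `ν ∈ ℝ`. For each `ν ∈ ℝ`, there are countably many such solutions … each corresponding to
a real value of `λ̄`" — here: every `λ̄` admitting a non-trivial solution regular at both poles is
real. [cite: CasalsTeixeiradacosta2022, Lemma 3.1] -/
theorem masterAngularEigenvalue_real {a Λ s μ : ℝ} {ν : ℂ} {m : ℝ} {lamBar : ℂ} (hν : ν.im = 0)
    (h : IsMasterAngularEigenvalue a Λ s μ ν m lamBar) : lamBar.im = 0 := by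
  obtain ⟨S, ⟨S', S'', hS⟩, hreg, hnt⟩ := h
  exact im_eq_zero_of_angularODE_real (V := fun x => masterAngularPotential a Λ s μ ν m lamBar x)
    hS hreg hnt (fun x _ => im_masterAngularPotential_of_real a Λ s μ hν m lamBar x)

/-- Teukolsky form (`μ = 1`, `ν = aω`, STU/Hatsuda separation constant `λ`, `Λ ≥ 0`): for real `ω`
every angular eigenvalue `λ` is real. [cite: CasalsTeixeiradacosta2022, Lemma 3.1] -/
theorem angularEigenvalue_real {a Λ s : ℝ} (hΛ : 0 ≤ Λ) {ω : ℂ} {m : ℝ} {lam : ℂ} (hω : ω.im = 0)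
    (h : IsAngularEigenvalue a Λ s ω m lam) : lam.im = 0 := by
  obtain ⟨S, hS, hreg, hnt⟩ := h
  have hm : IsMasterAngularEigenvalue a Λ s 1 ((a : ℂ) * ω) m (lambdaBar a Λ s ω m lam) :=
    ⟨S, (isMasterAngularSolution_one_iff a Λ s hΛ ω m lam S).2 hS, hreg, hnt⟩
  have hν : ((a : ℂ) * ω).im = 0 := by simp [mul_im, hω]
  have key := masterAngularEigenvalue_real hν hm
  simp only [lambdaBar, sub_im, add_im, mul_im, ofReal_re, ofReal_im, pow_two, hω, mul_zero,
    zero_mul, add_zero, sub_zero, mul_re, sub_re, Complex.im_ofNat] at key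
  linarith

/-! ### Boundary flux of a purely oscillatory complex-exponent branch (`Re z = 0`) -/

/-- Boundary behaviour of a branch with PURELY IMAGINARY exponent (real frequency at a horizon). In
the setting of `tendsto_boundaryFlux_of_cpowBranch` but with `Re z = 0`: the flux density
`u · S' · conj S = u^{2Re z}(cz|g|² + u g'ḡ)` now tends to `c z |g(x₀)|²` — the printed boundary values
`|u(∓∞)|²` of the real-frequency identity "if `Im ω = 0`,
`0 = ω(ω−mϖ₁)|u(−∞)|² + ω(ω−mϖ₂)|u(+∞)|²`". [cite: CasalsTeixeiradacosta2022, Theorem 3.10 (proof, Step 1)] -/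
theorem tendsto_boundaryFlux_of_cpowBranch_of_re_eq_zero
    {U J : Set ℝ} {x₀ : ℝ} (hU : IsOpen U) (hx₀ : x₀ ∈ U) (hJ : IsOpen J) (hJU : J ⊆ U)
    {g : ℝ → ℂ} (hg : ContDiffOn ℝ ((⊤ : ℕ∞) : WithTop ℕ∞) g U)
    {u : ℝ → ℝ} {c : ℝ} (hu : ∀ x, HasDerivAt u c x) (hu0 : u x₀ = 0) (hupos : ∀ x ∈ J, 0 < u x)
    {z : ℂ} (hz : z.re = 0) {S S' : ℝ → ℂ} (hS : ∀ x ∈ J, HasDerivAt S (S' x) x)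
    (hSg : ∀ x ∈ J, S x = ((u x : ℝ) : ℂ) ^ z * g x) :
    Tendsto (fun x => ((u x : ℝ) : ℂ) * S' x * conj (S x)) (𝓝[J] x₀)
      (𝓝 (z * (c : ℂ) * (g x₀ * conj (g x₀)))) := by
  have h1 : (1 : WithTop ℕ∞) ≤ ((⊤ : ℕ∞) : WithTop ℕ∞) := by exact_mod_cast le_top
  have h0 : ((⊤ : ℕ∞) : WithTop ℕ∞) ≠ 0 := by simp
  have hgd : DifferentiableOn ℝ g U := hg.differentiableOn h0
  have hgc : ContinuousAt g x₀ :=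
    (hgd.continuousOn.continuousWithinAt hx₀).continuousAt (hU.mem_nhds hx₀)
  have hg'c : ContinuousAt (deriv g) x₀ :=
    ((hg.continuousOn_deriv_of_isOpen hU h1).continuousWithinAt hx₀).continuousAt (hU.mem_nhds hx₀)
  -- the derivative of `S` on `J`, from the branch representation
  have hS' : ∀ x ∈ J, S' x = z * ((u x : ℝ) : ℂ) ^ (z - 1) * (c : ℂ) * g x +
      ((u x : ℝ) : ℂ) ^ z * deriv g x := by
    intro x hx
    have hgx : HasDerivAt g (deriv g x) x :=
      ((hgd x (hJU hx)).differentiableAt (hU.mem_nhds (hJU hx))).hasDerivAt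
    have hux : HasDerivAt (fun y => ((u y : ℝ) : ℂ)) (c : ℂ) x := (hu x).ofReal_comp
    have hslit : ((u x : ℝ) : ℂ) ∈ slitPlane := Complex.ofReal_mem_slitPlane.2 (hupos x hx)
    have hpow' : HasDerivAt ((fun w : ℂ => w ^ z) ∘ fun y => ((u y : ℝ) : ℂ))
        (z * ((u x : ℝ) : ℂ) ^ (z - 1) * (c : ℂ)) x :=
      (Complex.hasStrictDerivAt_cpow_const (c := z) hslit).hasDerivAt.comp x hux
    have hpow : HasDerivAt (fun y => ((u y : ℝ) : ℂ) ^ z)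
        (z * ((u x : ℝ) : ℂ) ^ (z - 1) * (c : ℂ)) x := by
      simpa only [Function.comp_def] using hpow'
    have hprod := hpow.mul hgx
    have heq : S =ᶠ[𝓝 x] fun y => ((u y : ℝ) : ℂ) ^ z * g y :=
      Filter.eventually_of_mem (hJ.mem_nhds hx) fun y hy => hSg y hy
    exact (hS x hx).unique (hprod.congr_of_eventuallyEq heq)
  -- the flux density on `J` (with `u^{2 Re z} = 1`)
  have hflux : ∀ x ∈ J, ((u x : ℝ) : ℂ) * S' x * conj (S x) =
      z * (c : ℂ) * (g x * conj (g x)) + ((u x : ℝ) : ℂ) * (deriv g x * conj (g x)) := by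
    intro x hx
    have hU0 : 0 < u x := hupos x hx
    have hne : ((u x : ℝ) : ℂ) ≠ 0 := by exact_mod_cast hU0.ne'
    have e1 : ((u x : ℝ) : ℂ) * ((u x : ℝ) : ℂ) ^ (z - 1) = ((u x : ℝ) : ℂ) ^ z := by
      rw [cpow_sub _ _ hne, cpow_one]
      field_simp
    have e2 : ((u x : ℝ) : ℂ) ^ z * conj (((u x : ℝ) : ℂ) ^ z) = 1 := by
      rw [Complex.mul_conj, Complex.normSq_eq_norm_sq, Complex.norm_cpow_eq_rpow_re_of_pos hU0, hz,
        Real.rpow_zero]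
      norm_num
    have hS'' : ((u x : ℝ) : ℂ) * S' x =
        ((u x : ℝ) : ℂ) ^ z * (z * (c : ℂ) * g x + ((u x : ℝ) : ℂ) * deriv g x) := by
      rw [hS' x hx, ← e1]
      ring
    calc ((u x : ℝ) : ℂ) * S' x * conj (S x)
        = (((u x : ℝ) : ℂ) * S' x) * conj (S x) := by ring
      _ = (((u x : ℝ) : ℂ) ^ z * (z * (c : ℂ) * g x + ((u x : ℝ) : ℂ) * deriv g x)) *
            (conj (((u x : ℝ) : ℂ) ^ z) * conj (g x)) := by rw [hS'', hSg x hx, map_mul]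
      _ = (((u x : ℝ) : ℂ) ^ z * conj (((u x : ℝ) : ℂ) ^ z)) *
            (z * (c : ℂ) * (g x * conj (g x)) + ((u x : ℝ) : ℂ) * (deriv g x * conj (g x))) := by
          ring
      _ = z * (c : ℂ) * (g x * conj (g x)) + ((u x : ℝ) : ℂ) * (deriv g x * conj (g x)) := by
          rw [e2, one_mul]
  -- the model expression tends to `z c |g(x₀)|²`
  have hu_t : Tendsto u (𝓝 x₀) (𝓝 0) := by
    simpa [hu0] using (hu x₀).continuousAt.tendsto
  have t3 : Tendsto g (𝓝 x₀) (𝓝 (g x₀)) := hgc.tendsto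
  have t3c : Tendsto (fun x => conj (g x)) (𝓝 x₀) (𝓝 (conj (g x₀))) :=
    (Complex.continuous_conj.tendsto _).comp t3
  have t4 : Tendsto (deriv g) (𝓝 x₀) (𝓝 (deriv g x₀)) := hg'c.tendsto
  have hb : Tendsto (fun x => z * (c : ℂ) * (g x * conj (g x)) +
      ((u x : ℝ) : ℂ) * (deriv g x * conj (g x))) (𝓝 x₀)
      (𝓝 (z * (c : ℂ) * (g x₀ * conj (g x₀)) + ((0 : ℝ) : ℂ) * (deriv g x₀ * conj (g x₀)))) :=
    ((t3.mul t3c).const_mul _).add (hu_t.ofReal.mul (t4.mul t3c))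
  simp only [Complex.ofReal_zero, zero_mul, add_zero] at hb
  refine (hb.mono_left nhdsWithin_le_nhds).congr' ?_
  filter_upwards [self_mem_nhdsWithin] with x hx
  exact (hflux x hx).symm


/-! ### Unique continuation at a regular singular endpoint: vanishing leading coefficient -/

/-- **Unique continuation across a horizon (regular singular point) for a Frobenius branch whose
leading coefficient vanishes.** Abstract form, approached from the right of `x₀`: on
`J = (x₀, x₀ + ε)` let `R = (x − x₀)^z · f` with `Re z ≥ 0`, `f` smooth on `(x₀ − ε, x₀ + ε)` and
`f(x₀) = 0`, and let `R` solve `ℓ(x)(x − x₀) R'' + D(x) R' + V(x) R = 0` on `J` (`ℓ ≠ 0` there). If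
the transformed coefficients `P = 2z + D/ℓ` and `Q` with `ℓ(x − x₀)Q = ℓ(z² − z) + zD + V(x − x₀)`
(for `f`: `(x − x₀) f'' + P f' + Q f = 0`) extend continuously to `(x₀ − ε, x₀ + ε)` with
`Re P(x₀) > 0` (the indicial cancellation), then `R ≡ 0` on some `(x₀, x₀ + T)`. This is the "unique
continuation for ODEs such as (3.9)" appealed to in the printed real-frequency argument, reduced to
`Costa2019.eq_zero_of_regularSingular`. [cite: CasalsTeixeiradacosta2022, Theorem 3.10 (proof, Step 1)] -/
theorem eq_zero_near_of_cpowBranch_zero {x₀ ε : ℝ} (hε : 0 < ε) {z : ℂ}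
    {ℓ D : ℝ → ℝ} {V : ℝ → ℂ} {f : ℝ → ℂ}
    (hf : ContDiffOn ℝ ((⊤ : ℕ∞) : WithTop ℕ∞) f (Ioo (x₀ - ε) (x₀ + ε))) (hf0 : f x₀ = 0)
    {R R' R'' : ℝ → ℂ}
    (hR : ∀ r ∈ Ioo x₀ (x₀ + ε), HasDerivAt R (R' r) r ∧ HasDerivAt R' (R'' r) r ∧
      (ℓ r : ℂ) * ((r - x₀ : ℝ) : ℂ) * R'' r + (D r : ℂ) * R' r + V r * R r = 0)
    (hRf : ∀ r ∈ Ioo x₀ (x₀ + ε), R r = ((r - x₀ : ℝ) : ℂ) ^ z * f r)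
    (hℓ : ∀ r ∈ Ioo x₀ (x₀ + ε), ℓ r ≠ 0)
    {P Q : ℝ → ℂ} (hP : ContinuousOn P (Ioo (x₀ - ε) (x₀ + ε)))
    (hQ : ContinuousOn Q (Ioo (x₀ - ε) (x₀ + ε))) (hP0 : 0 < (P x₀).re)
    (hPJ : ∀ r ∈ Ioo x₀ (x₀ + ε), (ℓ r : ℂ) * P r = 2 * z * ℓ r + D r)
    (hQJ : ∀ r ∈ Ioo x₀ (x₀ + ε),
      (ℓ r : ℂ) * ((r - x₀ : ℝ) : ℂ) * Q r =
        (ℓ r : ℂ) * (z ^ 2 - z) + z * (D r : ℂ) + V r * ((r - x₀ : ℝ) : ℂ)) :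
    ∃ T, 0 < T ∧ ∀ r ∈ Ioo x₀ (x₀ + T), R r = 0 := by
  set U : Set ℝ := Ioo (x₀ - ε) (x₀ + ε) with hU
  have hUo : IsOpen U := isOpen_Ioo
  have hx₀U : x₀ ∈ U := ⟨by linarith, by linarith⟩
  have hJU : Ioo x₀ (x₀ + ε) ⊆ U := fun r hr => ⟨by linarith [hr.1], hr.2⟩
  have htop0 : ((⊤ : ℕ∞) : WithTop ℕ∞) ≠ 0 := by simp
  have h11 : (1 : WithTop ℕ∞) + 1 ≤ ((⊤ : ℕ∞) : WithTop ℕ∞) := WithTop.coe_le_coe.mpr le_top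
  -- `w = f'`, `w' = f''` on `U`
  set w : ℝ → ℂ := deriv f with hw_def
  have hw1 : ContDiffOn ℝ 1 w U := hf.deriv_of_isOpen hUo h11
  have hfd : ∀ r ∈ U, HasDerivAt f (w r) r := fun r hr =>
    (((hf.differentiableOn htop0) r hr).differentiableAt (hUo.mem_nhds hr)).hasDerivAt
  have hwd : ∀ r ∈ U, HasDerivAt w (deriv w r) r := fun r hr =>
    (((hw1.differentiableOn one_ne_zero) r hr).differentiableAt (hUo.mem_nhds hr)).hasDerivAt
  have hwc : ContinuousOn w U := hw1.continuousOn
  -- notation on `J`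
  have hTne : ∀ r ∈ Ioo x₀ (x₀ + ε), ((r - x₀ : ℝ) : ℂ) ≠ 0 := fun r hr => by
    have : (0 : ℝ) < r - x₀ := by linarith [hr.1]
    exact_mod_cast this.ne'
  have hEne : ∀ r ∈ Ioo x₀ (x₀ + ε), ((r - x₀ : ℝ) : ℂ) ^ (-z) ≠ 0 := fun r hr => by
    rw [Ne, cpow_eq_zero_iff, not_and_or]; exact Or.inl (hTne r hr)
  -- derivative of `E = (x − x₀)^{−z}`
  have hE : ∀ r ∈ Ioo x₀ (x₀ + ε), HasDerivAt (fun y : ℝ => ((y - x₀ : ℝ) : ℂ) ^ (-z))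
      (-z * ((r - x₀ : ℝ) : ℂ) ^ (-z) / ((r - x₀ : ℝ) : ℂ)) r := by
    intro r hr
    have hpos : (0 : ℝ) < r - x₀ := by linarith [hr.1]
    have hux : HasDerivAt (fun y : ℝ => ((y - x₀ : ℝ) : ℂ)) 1 r := by
      simpa using ((hasDerivAt_id r).sub_const x₀).ofReal_comp
    have hslit : ((r - x₀ : ℝ) : ℂ) ∈ slitPlane := Complex.ofReal_mem_slitPlane.2 hpos
    have h := (Complex.hasStrictDerivAt_cpow_const (c := -z) hslit).hasDerivAt.comp r hux
    have h' : HasDerivAt (fun y : ℝ => ((y - x₀ : ℝ) : ℂ) ^ (-z))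
        (-z * ((r - x₀ : ℝ) : ℂ) ^ (-z - 1) * 1) r := by
      simpa only [Function.comp_def] using h
    refine h'.congr_deriv ?_
    rw [cpow_sub _ _ (hTne r hr), cpow_one]
    field_simp
  -- `f = E · R` on `J`
  have hfE : ∀ r ∈ Ioo x₀ (x₀ + ε), f r = ((r - x₀ : ℝ) : ℂ) ^ (-z) * R r := by
    intro r hr
    have hpow : ((r - x₀ : ℝ) : ℂ) ^ z ≠ 0 := by
      rw [Ne, cpow_eq_zero_iff, not_and_or]; exact Or.inl (hTne r hr)
    rw [hRf r hr, cpow_neg, ← mul_assoc, inv_mul_cancel₀ hpow, one_mul]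
  -- `w` on `J`
  have hwJ : ∀ r ∈ Ioo x₀ (x₀ + ε),
      w r = ((r - x₀ : ℝ) : ℂ) ^ (-z) * (R' r - z * R r / ((r - x₀ : ℝ) : ℂ)) := by
    intro r hr
    obtain ⟨h1, -, -⟩ := hR r hr
    have hd := ((hE r hr).mul h1)
    have heq : f =ᶠ[𝓝 r] fun y => ((y - x₀ : ℝ) : ℂ) ^ (-z) * R y :=
      Filter.eventually_of_mem (isOpen_Ioo.mem_nhds hr) fun y hy => hfE y hy
    have hd' : HasDerivAt f (-z * ((r - x₀ : ℝ) : ℂ) ^ (-z) / ((r - x₀ : ℝ) : ℂ) * R r +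
        ((r - x₀ : ℝ) : ℂ) ^ (-z) * R' r) r := hd.congr_of_eventuallyEq heq
    rw [hw_def, hd'.deriv]
    have hT := hTne r hr
    field_simp
    ring
  -- `w'` on `J`
  have hw'J : ∀ r ∈ Ioo x₀ (x₀ + ε),
      deriv w r = ((r - x₀ : ℝ) : ℂ) ^ (-z) *
        (R'' r - 2 * z * R' r / ((r - x₀ : ℝ) : ℂ) + (z ^ 2 + z) * R r / ((r - x₀ : ℝ) : ℂ) ^ 2) := by
    intro r hr
    obtain ⟨h1, h2, -⟩ := hR r hr
    have hT := hTne r hr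
    have hux : HasDerivAt (fun y : ℝ => ((y - x₀ : ℝ) : ℂ)) 1 r := by
      simpa using ((hasDerivAt_id r).sub_const x₀).ofReal_comp
    have hin : HasDerivAt (fun y => R' y - z * R y / ((y - x₀ : ℝ) : ℂ))
        (R'' r - (z * R' r * ((r - x₀ : ℝ) : ℂ) - z * R r * 1) / ((r - x₀ : ℝ) : ℂ) ^ 2) r :=
      h2.sub ((h1.const_mul z).div hux hT)
    have hd := (hE r hr).mul hin
    have heq : w =ᶠ[𝓝 r] fun y => ((y - x₀ : ℝ) : ℂ) ^ (-z) * (R' y - z * R y / ((y - x₀ : ℝ) : ℂ)) :=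
      Filter.eventually_of_mem (isOpen_Ioo.mem_nhds hr) fun y hy => hwJ y hy
    rw [(hd.congr_of_eventuallyEq heq).deriv]
    field_simp
    ring
  -- the transformed ODE for `f` on `J`
  have hodef : ∀ r ∈ Ioo x₀ (x₀ + ε),
      ((r - x₀ : ℝ) : ℂ) * deriv w r + P r * w r + Q r * f r = 0 := by
    intro r hr
    obtain ⟨-, -, hode⟩ := hR r hr
    have hT := hTne r hr
    have hl : (ℓ r : ℂ) ≠ 0 := by exact_mod_cast hℓ r hr
    have hP' : P r = (2 * z * ℓ r + D r) / ℓ r := by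
      rw [eq_div_iff hl, mul_comm]; exact hPJ r hr
    have hQ' : Q r = ((ℓ r : ℂ) * (z ^ 2 - z) + z * (D r : ℂ) + V r * ((r - x₀ : ℝ) : ℂ)) /
        ((ℓ r : ℂ) * ((r - x₀ : ℝ) : ℂ)) := by
      rw [eq_div_iff (mul_ne_zero hl hT), mul_comm]; exact hQJ r hr
    have hR'' : R'' r = -((D r : ℂ) * R' r + V r * R r) / ((ℓ r : ℂ) * ((r - x₀ : ℝ) : ℂ)) := by
      rw [eq_div_iff (mul_ne_zero hl hT)]
      linear_combination hode
    rw [hw'J r hr, hwJ r hr, hfE r hr, hP', hQ', hR'']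
    field_simp
    ring
  -- choice of `T`: positivity of `Re P`, bound on `Q`
  have hPca : ContinuousAt P x₀ := (hP.continuousWithinAt hx₀U).continuousAt (hUo.mem_nhds hx₀U)
  have hPev : ∀ᶠ r in 𝓝 x₀, (P x₀).re / 2 < (P r).re :=
    ((Complex.continuous_re.tendsto _).comp hPca).eventually (lt_mem_nhds (by linarith))
  obtain ⟨δ, hδ, hδP⟩ := Metric.eventually_nhds_iff.1 hPev
  have hKsub : Icc x₀ (x₀ + ε / 2) ⊆ U := fun r hr => ⟨by linarith [hr.1], by linarith [hr.2]⟩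
  obtain ⟨C, hC⟩ := isCompact_Icc.exists_bound_of_continuousOn (hQ.mono hKsub)
  set B : ℝ := max C 0 with hB
  have hB0 : 0 ≤ B := le_max_right _ _
  set T : ℝ := min (ε / 2) (min (δ / 2) (1 / (2 * (B + 1)))) with hT
  have hTpos : 0 < T := by
    refine lt_min (by linarith) (lt_min (by linarith) ?_)
    positivity
  have hTε : T ≤ ε / 2 := min_le_left _ _
  have hTδ : T ≤ δ / 2 := (min_le_right _ _).trans (min_le_left _ _)
  have hTB : T ≤ 1 / (2 * (B + 1)) := (min_le_right _ _).trans (min_le_right _ _)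
  have hBT : B * T ≤ 1 / 2 := by
    calc B * T ≤ B * (1 / (2 * (B + 1))) := mul_le_mul_of_nonneg_left hTB hB0
      _ = (B / (B + 1)) * (1 / 2) := by field_simp
      _ ≤ 1 * (1 / 2) := by
          refine mul_le_mul_of_nonneg_right ?_ (by norm_num)
          rw [div_le_one (by linarith)]; linarith
      _ = 1 / 2 := by ring
  have hIccU : Icc x₀ (x₀ + T) ⊆ U := fun r hr => hKsub ⟨hr.1, hr.2.trans (by linarith)⟩
  have hIocJ : Ioc x₀ (x₀ + T) ⊆ Ioo x₀ (x₀ + ε) := fun r hr =>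
    ⟨hr.1, lt_of_le_of_lt hr.2 (by linarith)⟩
  have key := Kerr.Costa2019.eq_zero_of_regularSingular (f := f) (w := w) (w' := deriv w) (P := P)
    (Q := Q) (xl := x₀ - ε) (xr := x₀ + ε) (x₀ := x₀) (T := T) (c := (P x₀).re / 2) (BQ := B)
    hTpos (by linarith) (by linarith) (by linarith) hB0 hBT hf0
    (fun x hx => hfd x (hIccU hx)) (fun x hx => hwd x (hIccU ⟨hx.1.le, hx.2⟩))
    (hwc.mono hIccU) hP hQ
    (fun x hx => (hδP (by
      rw [Real.dist_eq, abs_lt]; constructor <;> linarith [hx.1, hx.2])).le)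
    (fun x hx => (hC x ⟨hx.1, hx.2.trans (by linarith)⟩).trans (le_max_left _ _))
    (fun x hx => hodef x (hIocJ hx))
  refine ⟨T, hTpos, fun r hr => ?_⟩
  rw [hRf r ⟨hr.1, lt_of_lt_of_le hr.2 (by linarith)⟩, key r ⟨hr.1.le, hr.2.le⟩, mul_zero]

/-! ### Global uniqueness on the exterior: a radial solution vanishing near one point vanishes -/

/-- The master radial coefficient is continuous away from the zeros of `Δ_r` (it is a rational
function of `r`). [cite: CasalsTeixeiradacosta2022, (3.8)] -/
theorem continuousOn_masterRadialPotential (M a Λ s μ : ℝ) (ω : ℂ) (m : ℝ) (lamBar : ℂ)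
    {S : Set ℝ} (hS : ∀ r ∈ S, delta M a Λ r ≠ 0) :
    ContinuousOn (fun r => masterRadialPotential M a Λ s μ ω m lamBar r) S := by
  have hS' : ∀ r ∈ S, (delta M a Λ r : ℂ) ≠ 0 := fun r hr => by exact_mod_cast hS r hr
  have hΔ : Continuous fun r : ℝ => (delta M a Λ r : ℂ) := by
    unfold delta; fun_prop
  have hΔ' : Continuous fun r : ℝ => (deltaDeriv M a Λ r : ℂ) := by
    unfold deltaDeriv; fun_prop
  have hK : Continuous fun r : ℝ => radialK a ω m r := by
    unfold radialK; fun_prop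
  unfold masterRadialPotential
  refine ((((((((continuous_const.mul (hK.pow 2)).sub
      (((continuous_const.mul hK)).mul hΔ')).continuousOn.div hΔ.continuousOn hS').add
      (by fun_prop)).sub (by fun_prop)).add continuousOn_const).sub continuousOn_const).add
      (by fun_prop)).sub (by fun_prop)

/-- **Unique continuation along the exterior.** A classical solution of the radial master equation
on `(r₊, r_c)` (any spin `s`, any `μ`; `Δ_r ≠ 0` there) that vanishes on a neighbourhood of one
point vanishes identically (Grönwall uniqueness for the linear equation
`R'' = −((s+1)Δ_r'/Δ_r) R' − (V/Δ_r) R`, `Literature.Analysis.ODE.eqOn_of_solution_Ioo`).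
[cite: CasalsTeixeiradacosta2022, Theorem 3.10 (proof, Step 1)] -/
theorem masterRadial_eq_zero_of_eventuallyEq_zero {M a Λ s μ : ℝ} {ω : ℂ} {m : ℝ} {lamBar : ℂ}
    (hΔ : ∀ r ∈ Ioo (rPlus M a Λ) (rCosmo M a Λ), delta M a Λ r ≠ 0)
    {R : ℝ → ℂ} (hR : IsMasterRadialSolution M a Λ s μ ω m lamBar R)
    {r₁ : ℝ} (hr₁ : r₁ ∈ Ioo (rPlus M a Λ) (rCosmo M a Λ)) (h0 : ∀ᶠ r in 𝓝 r₁, R r = 0) :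
    ∀ r ∈ Ioo (rPlus M a Λ) (rCosmo M a Λ), R r = 0 := by
  obtain ⟨R', R'', hode⟩ := hR
  set p : ℝ → ℂ := fun r => -(((s + 1 : ℝ) : ℂ) * (deltaDeriv M a Λ r : ℂ)) / (delta M a Λ r : ℂ)
    with hp
  set q : ℝ → ℂ := fun r => -masterRadialPotential M a Λ s μ ω m lamBar r / (delta M a Λ r : ℂ)
    with hq
  have hΔc : ∀ r ∈ Ioo (rPlus M a Λ) (rCosmo M a Λ), (delta M a Λ r : ℂ) ≠ 0 := fun r hr => by
    exact_mod_cast hΔ r hr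
  have hcΔ : Continuous fun r : ℝ => (delta M a Λ r : ℂ) := by unfold delta; fun_prop
  have hcΔ' : Continuous fun r : ℝ => (deltaDeriv M a Λ r : ℂ) := by unfold deltaDeriv; fun_prop
  have hpc : ContinuousOn p (Ioo (rPlus M a Λ) (rCosmo M a Λ)) :=
    ((continuous_const.mul hcΔ').neg.continuousOn).div hcΔ.continuousOn hΔc
  have hqc : ContinuousOn q (Ioo (rPlus M a Λ) (rCosmo M a Λ)) :=
    (continuousOn_masterRadialPotential M a Λ s μ ω m lamBar hΔ).neg.div hcΔ.continuousOn hΔc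
  have hu : ∀ t ∈ Ioo (rPlus M a Λ) (rCosmo M a Λ),
      HasDerivAt R (R' t) t ∧ HasDerivAt R' (p t * R' t + q t * R t) t := by
    intro t ht
    obtain ⟨h1, h2, heq⟩ := hode t ht
    refine ⟨h1, h2.congr_deriv ?_⟩
    have hne := hΔc t ht
    rw [hp, hq]
    field_simp
    linear_combination heq
  have hv : ∀ t ∈ Ioo (rPlus M a Λ) (rCosmo M a Λ),
      HasDerivAt (fun _ : ℝ => (0 : ℂ)) ((fun _ : ℝ => (0 : ℂ)) t) t ∧
        HasDerivAt (fun _ : ℝ => (0 : ℂ)) (p t * (fun _ : ℝ => (0 : ℂ)) t + q t * (fun _ : ℝ => (0 : ℂ)) t) t := by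
    intro t _
    refine ⟨hasDerivAt_const t 0, ?_⟩
    simpa using hasDerivAt_const t (0 : ℂ)
  have hR0 : R r₁ = 0 := h0.self_of_nhds
  have hR'0 : R' r₁ = 0 := by
    have h1 := (hode r₁ hr₁).1
    have h2 : HasDerivAt R 0 r₁ :=
      (hasDerivAt_const r₁ (0 : ℂ)).congr_of_eventuallyEq (h0.mono fun r hr => hr)
    exact h1.unique h2
  have key := _root_.Literature.Analysis.ODE.eqOn_of_solution_Ioo (𝕜 := ℂ) hpc hqc hr₁
    (u := R) (u' := R') (v := fun _ => (0 : ℂ)) (v' := fun _ => (0 : ℂ)) hu hv hR0 hR'0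
  exact fun r hr => key.1 hr


/-- The mirror image of `eq_zero_near_of_cpowBranch_zero`: the singular point `x₀` approached from
the LEFT, branch `R = (x₀ − x)^z · f` on `(x₀ − ε, x₀)`, same equation
`ℓ(x)(x − x₀)R'' + D R' + V R = 0` and same transformed coefficients (`ℓP = 2zℓ + D`,
`ℓ(x − x₀)Q = ℓ(z² − z) + zD + V(x − x₀)`); reduced to the right-hand version by the reflection
`x ↦ 2x₀ − x`. [cite: CasalsTeixeiradacosta2022, Theorem 3.10 (proof, Step 1)] -/
theorem eq_zero_near_of_cpowBranch_zero_left {x₀ ε : ℝ} (hε : 0 < ε) {z : ℂ}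
    {ℓ D : ℝ → ℝ} {V : ℝ → ℂ} {f : ℝ → ℂ}
    (hf : ContDiffOn ℝ ((⊤ : ℕ∞) : WithTop ℕ∞) f (Ioo (x₀ - ε) (x₀ + ε))) (hf0 : f x₀ = 0)
    {R R' R'' : ℝ → ℂ}
    (hR : ∀ r ∈ Ioo (x₀ - ε) x₀, HasDerivAt R (R' r) r ∧ HasDerivAt R' (R'' r) r ∧
      (ℓ r : ℂ) * ((r - x₀ : ℝ) : ℂ) * R'' r + (D r : ℂ) * R' r + V r * R r = 0)
    (hRf : ∀ r ∈ Ioo (x₀ - ε) x₀, R r = ((x₀ - r : ℝ) : ℂ) ^ z * f r)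
    (hℓ : ∀ r ∈ Ioo (x₀ - ε) x₀, ℓ r ≠ 0)
    {P Q : ℝ → ℂ} (hP : ContinuousOn P (Ioo (x₀ - ε) (x₀ + ε)))
    (hQ : ContinuousOn Q (Ioo (x₀ - ε) (x₀ + ε))) (hP0 : 0 < (P x₀).re)
    (hPJ : ∀ r ∈ Ioo (x₀ - ε) x₀, (ℓ r : ℂ) * P r = 2 * z * ℓ r + D r)
    (hQJ : ∀ r ∈ Ioo (x₀ - ε) x₀,
      (ℓ r : ℂ) * ((r - x₀ : ℝ) : ℂ) * Q r =
        (ℓ r : ℂ) * (z ^ 2 - z) + z * (D r : ℂ) + V r * ((r - x₀ : ℝ) : ℂ)) :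
    ∃ T, 0 < T ∧ ∀ r ∈ Ioo (x₀ - T) x₀, R r = 0 := by
  -- the reflection `φ y = 2x₀ − y`
  set φ : ℝ → ℝ := fun y => 2 * x₀ - y with hφ
  have hφd : ∀ y, HasDerivAt φ (-1) y := fun y => by
    simpa [hφ] using (hasDerivAt_id y).const_sub (2 * x₀)
  have hφc : Continuous φ := by rw [hφ]; fun_prop
  have hφU : MapsTo φ (Ioo (x₀ - ε) (x₀ + ε)) (Ioo (x₀ - ε) (x₀ + ε)) := fun y hy =>
    ⟨by simp only [hφ]; linarith [hy.2], by simp only [hφ]; linarith [hy.1]⟩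
  have hφJ : ∀ y ∈ Ioo x₀ (x₀ + ε), φ y ∈ Ioo (x₀ - ε) x₀ := fun y hy =>
    ⟨by simp only [hφ]; linarith [hy.2], by simp only [hφ]; linarith [hy.1]⟩
  have hsub : ∀ y, ((φ y - x₀ : ℝ) : ℂ) = -((y - x₀ : ℝ) : ℂ) := fun y => by
    simp only [hφ]; push_cast; ring
  have hsub' : ∀ y, ((x₀ - φ y : ℝ) : ℂ) = ((y - x₀ : ℝ) : ℂ) := fun y => by
    simp only [hφ]; push_cast; ring
  have hcd : ContDiff ℝ ((⊤ : ℕ∞) : WithTop ℕ∞) φ := by rw [hφ]; fun_prop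
  obtain ⟨T, hT, hzero⟩ := eq_zero_near_of_cpowBranch_zero (x₀ := x₀) hε (z := z)
    (ℓ := fun y => ℓ (φ y)) (D := fun y => D (φ y)) (V := fun y => -V (φ y)) (f := fun y => f (φ y))
    (hf.comp hcd.contDiffOn hφU) (by simp [hφ, two_mul, hf0])
    (R := fun y => R (φ y)) (R' := fun y => -R' (φ y)) (R'' := fun y => R'' (φ y))
    (fun y hy => by
      obtain ⟨h1, h2, hode⟩ := hR (φ y) (hφJ y hy)
      refine ⟨?_, ?_, ?_⟩
      · have h := h1.scomp y (hφd y)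
        simpa [Function.comp_def] using h
      · have h2' : HasDerivAt (fun r => -R' r) (-R'' (φ y)) (φ y) := h2.neg
        have h := h2'.scomp y (hφd y)
        simpa [Function.comp_def] using h
      · rw [hsub y] at hode
        linear_combination (-1 : ℂ) * hode)
    (fun y hy => by rw [hRf (φ y) (hφJ y hy), hsub' y])
    (fun y hy => hℓ (φ y) (hφJ y hy))
    (P := fun y => P (φ y)) (Q := fun y => -Q (φ y))
    (hP.comp hφc.continuousOn hφU) ((hQ.comp hφc.continuousOn hφU).neg)
    (by simpa [hφ, two_mul] using hP0)
    (fun y hy => hPJ (φ y) (hφJ y hy))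
    (fun y hy => by
      have h := hQJ (φ y) (hφJ y hy)
      rw [hsub y] at h
      linear_combination h)
  refine ⟨T, hT, fun r hr => ?_⟩
  have h := hzero (φ r) ⟨by simp only [hφ]; linarith [hr.2], by simp only [hφ]; linarith [hr.1]⟩
  simpa [hφ] using h

/-! ### The Kerr–de Sitter horizons as regular singular points of the `s = 0` radial equation -/

/-- The square of a horizon exponent: `B(r_h)² = −Ξ²K(r_h)²/Δ_r'(r_h)²` (the indicial relation of the
transformed equation at `r_h`). [cite: Hatsuda2020, (2.18)] -/
theorem horizonB_sq (M a Λ : ℝ) (ω : ℂ) (m : ℝ) (rh : ℝ) :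
    horizonB M a Λ ω m rh ^ 2 =
      -((xi a Λ : ℂ) ^ 2 * radialK a ω m rh ^ 2 / (deltaDeriv M a Λ rh : ℂ) ^ 2) := by
  simp only [horizonB, div_pow, mul_pow, Complex.I_sq]
  ring

/-- Imaginary part of the horizon exponent: `Im B(r_h) = Ξ·Re K(r_h)/Δ_r'(r_h)`.
[cite: Hatsuda2020, (2.18)] -/
theorem im_horizonB (M a Λ : ℝ) (ω : ℂ) (m : ℝ) (rh : ℝ) :
    (horizonB M a Λ ω m rh).im = xi a Λ * (radialK a ω m rh).re / deltaDeriv M a Λ rh := by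
  simp only [horizonB]
  rw [Complex.div_ofReal_im]
  simp only [mul_re, mul_im, I_re, I_im, ofReal_re, ofReal_im]
  ring

/-- Real part of `K(r_h) = ω(r_h² + a²) − am`: `Re K = Re ω·(r_h² + a²) − am`.
[cite: Hatsuda2020, (2.14)] -/
theorem re_radialK (a : ℝ) (ω : ℂ) (m rh : ℝ) :
    (radialK a ω m rh).re = ω.re * (rh ^ 2 + a ^ 2) - a * m := by
  simp only [radialK, sub_re, mul_re, ofReal_re, ofReal_im]
  ring

/-- The `s = 0` master radial coefficient splits as `Ξ²K²/Δ_r` plus a part regular at the horizons,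
`−(2Λ/3)μr² − λ̄ + 2Ξ²amω − a²Ξ²ω²`. [cite: CasalsTeixeiradacosta2022, (3.8)] -/
theorem masterRadialPotential_zero_split (M a Λ μ : ℝ) (ω : ℂ) (m : ℝ) (lamBar : ℂ) (r : ℝ) :
    masterRadialPotential M a Λ 0 μ ω m lamBar r =
      (xi a Λ : ℂ) ^ 2 * radialK a ω m r ^ 2 / (delta M a Λ r : ℂ) +
        (-((2 * (Λ / 3) * μ * r ^ 2 : ℝ) : ℂ) - lamBar + 2 * (xi a Λ : ℂ) ^ 2 * (a : ℂ) * (m : ℂ) * ω -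
          (a : ℂ) ^ 2 * (xi a Λ : ℂ) ^ 2 * ω ^ 2) := by
  simp only [masterRadialPotential]
  push_cast
  ring

/-- **The transformed coefficients at a simple zero `p` of `Δ_r`** (`s = 0`). With the exact
factorisation `Δ_r(r) = (r − p)σ_p(r)` (`σ_p` a cubic with `σ_p(p) = Δ_r'(p)`), and for an exponent
`z` satisfying the indicial relation `z² = −Ξ²K(p)²/Δ_r'(p)²` (`z = ∓B(p)`), there are coefficients
`P`, `Q`, continuous near `p`, with `Re P(p) = 2Re z + 1`, `σ_p P = 2zσ_p + Δ_r'` and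
`σ_p(r − p)Q = σ_p(z² − z) + zΔ_r' + V·(r − p)` (the cancellation of the `1/(r − p)` singularity of
`Q` is the indicial relation). [cite: CasalsTeixeiradacosta2022, Theorem 3.10 (proof, Step 1)] -/
theorem exists_branchCoeffs (M a Λ μ : ℝ) (ω : ℂ) (m : ℝ) (lamBar : ℂ) {p : ℝ}
    (hp : delta M a Λ p = 0) (hd : deltaDeriv M a Λ p ≠ 0) {z : ℂ}
    (hz : z ^ 2 = -((xi a Λ : ℂ) ^ 2 * radialK a ω m p ^ 2 / (deltaDeriv M a Λ p : ℂ) ^ 2)) :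
    ∃ ε > 0, ∃ σ : ℝ → ℝ, ∃ P Q : ℝ → ℂ,
      (∀ r, delta M a Λ r = (r - p) * σ r) ∧ (∀ r ∈ Ioo (p - ε) (p + ε), σ r ≠ 0) ∧
      ContinuousOn P (Ioo (p - ε) (p + ε)) ∧ ContinuousOn Q (Ioo (p - ε) (p + ε)) ∧
      (P p).re = 2 * z.re + 1 ∧
      (∀ r ∈ Ioo (p - ε) (p + ε), (σ r : ℂ) * P r = 2 * z * σ r + deltaDeriv M a Λ r) ∧
      (∀ r ∈ Ioo (p - ε) (p + ε), r ≠ p →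
        (σ r : ℂ) * ((r - p : ℝ) : ℂ) * Q r =
          (σ r : ℂ) * (z ^ 2 - z) + z * (deltaDeriv M a Λ r : ℂ) +
            masterRadialPotential M a Λ 0 μ ω m lamBar r * ((r - p : ℝ) : ℂ)) := by
  -- the polynomial data of the factorisation `Δ = (r − p)σ`, `Δ' = σ + (r − p)σd`, `σ − Δ'(p) = (r − p)L`
  set d : ℝ := deltaDeriv M a Λ p with hd_def
  set c₂ : ℝ := 1 - Λ / 3 * a ^ 2 - 2 * Λ * p ^ 2 with hc₂
  set L : ℝ → ℝ := fun r => c₂ - 4 * Λ / 3 * p * (r - p) - Λ / 3 * (r - p) ^ 2 with hL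
  set σ : ℝ → ℝ := fun r => d + (r - p) * L r with hσ
  set σd : ℝ → ℝ := fun r => c₂ - 8 * Λ / 3 * p * (r - p) - Λ * (r - p) ^ 2 with hσd
  have hΔσ : ∀ r, delta M a Λ r = (r - p) * σ r := fun r => by
    rw [delta_taylor M a Λ p r, hp]
    simp only [hσ, hL, hc₂, hd_def]
    ring
  have hDσ : ∀ r, deltaDeriv M a Λ r = σ r + (r - p) * σd r := fun r => by
    simp only [hσ, hσd, hL, hc₂, hd_def, deltaDeriv]
    ring
  -- the frequency data
  set Kp : ℂ := radialK a ω m p with hKp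
  set ρ : ℝ → ℂ := fun r => ω * ((r + p : ℝ) : ℂ) * (d : ℂ) - Kp * (L r : ℂ) with hρ
  have hKρ : ∀ r, radialK a ω m r * (d : ℂ) - Kp * (σ r : ℂ) = ((r - p : ℝ) : ℂ) * ρ r := fun r => by
    simp only [hρ, hσ, hKp, radialK]
    push_cast
    ring
  set W : ℝ → ℂ := fun r => -((2 * (Λ / 3) * μ * r ^ 2 : ℝ) : ℂ) - lamBar +
    2 * (xi a Λ : ℂ) ^ 2 * (a : ℂ) * (m : ℂ) * ω - (a : ℂ) ^ 2 * (xi a Λ : ℂ) ^ 2 * ω ^ 2 with hW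
  set P : ℝ → ℂ := fun r => 2 * z + (deltaDeriv M a Λ r : ℂ) / (σ r : ℂ) with hP
  set Q : ℝ → ℂ := fun r =>
    ((xi a Λ : ℂ) ^ 2 * ρ r * (radialK a ω m r + (σ r : ℂ) * Kp / (d : ℂ)) / ((σ r : ℂ) * (d : ℂ)) +
        z * (σd r : ℂ) + W r) / (σ r : ℂ) with hQ
  -- a neighbourhood of `p` where `σ ≠ 0`
  have hσc : Continuous σ := by rw [hσ, hL]; fun_prop
  have hσp : σ p = d := by simp [hσ]
  have hev : ∀ᶠ r in 𝓝 p, σ r ≠ 0 := by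
    have h := hσc.continuousAt (x := p)
    rw [ContinuousAt, hσp] at h
    exact h.eventually_ne hd
  obtain ⟨ε, hε, hεσ⟩ := Metric.eventually_nhds_iff.1 hev
  have hσne : ∀ r ∈ Ioo (p - ε) (p + ε), σ r ≠ 0 := fun r hr =>
    hεσ (by rw [Real.dist_eq, abs_lt]; constructor <;> linarith [hr.1, hr.2])
  have hσne' : ∀ r ∈ Ioo (p - ε) (p + ε), (σ r : ℂ) ≠ 0 := fun r hr => by
    exact_mod_cast hσne r hr
  have hd' : (d : ℂ) ≠ 0 := by exact_mod_cast hd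
  refine ⟨ε, hε, σ, P, Q, hΔσ, hσne, ?_, ?_, ?_, ?_, ?_⟩
  · -- continuity of `P`
    have h1 : Continuous fun r : ℝ => (deltaDeriv M a Λ r : ℂ) := by unfold deltaDeriv; fun_prop
    have h2 : Continuous fun r : ℝ => (σ r : ℂ) := continuous_ofReal.comp hσc
    rw [hP]
    exact continuousOn_const.add (h1.continuousOn.div h2.continuousOn hσne')
  · -- continuity of `Q`
    have h2 : Continuous fun r : ℝ => (σ r : ℂ) := continuous_ofReal.comp hσc
    have hρc : Continuous ρ := by rw [hρ, hL]; fun_prop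
    have hKc : Continuous fun r : ℝ => radialK a ω m r := by unfold radialK; fun_prop
    have hσdc : Continuous fun r : ℝ => (σd r : ℂ) := by rw [hσd]; fun_prop
    have hWc : Continuous W := by rw [hW]; fun_prop
    rw [hQ]
    refine ContinuousOn.div ?_ h2.continuousOn hσne'
    refine ((ContinuousOn.div ?_ (h2.continuousOn.mul continuousOn_const) fun r hr =>
      mul_ne_zero (hσne' r hr) hd').add (continuousOn_const.mul hσdc.continuousOn)).add
      hWc.continuousOn
    exact ((continuousOn_const.mul hρc.continuousOn).mul
      (hKc.continuousOn.add ((h2.continuousOn.mul continuousOn_const).div continuousOn_const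
        fun _ _ => hd')))
  · -- `Re P(p) = 2 Re z + 1`
    have hσp' : (σ p : ℂ) = d := by rw [hσp]
    simp only [hP, hσp', ← hd_def, div_self hd', add_re, mul_re, one_re]
    norm_num
  · -- `σ P = 2zσ + Δ'`
    intro r hr
    simp only [hP]
    field_simp [hσne' r hr]
  · -- `σ (r − p) Q = σ(z² − z) + zΔ' + V (r − p)`
    intro r hr hrp
    have hσr := hσne' r hr
    have ht : ((r - p : ℝ) : ℂ) ≠ 0 := by exact_mod_cast sub_ne_zero.2 hrp
    have hρ' : ρ r = (radialK a ω m r * (d : ℂ) - Kp * (σ r : ℂ)) / ((r - p : ℝ) : ℂ) := by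
      rw [eq_div_iff ht, mul_comm]; exact (hKρ r).symm
    have hV : masterRadialPotential M a Λ 0 μ ω m lamBar r =
        (xi a Λ : ℂ) ^ 2 * radialK a ω m r ^ 2 / (((r - p : ℝ) : ℂ) * (σ r : ℂ)) + W r := by
      rw [masterRadialPotential_zero_split, hΔσ r]
      simp only [hW]
      push_cast
      ring
    have hDr : (deltaDeriv M a Λ r : ℂ) = σ r + ((r - p : ℝ) : ℂ) * σd r := by
      rw [hDσ r]; push_cast; ring
    simp only [hQ]
    rw [hV, hDr, hρ', hz]
    field_simp
    ring

/-- **An ingoing `s = 0` solution whose horizon amplitude vanishes is identically zero**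
(`Im ω ≥ 0`). On subextremal Kerr–de Sitter, let `R` solve the `s = 0` radial master equation on
`(r₊, r_c)` with `R(r)(r − r₊)^{B(r₊)} = f(r)` near `r₊`, `f` smooth at `r₊`. If `f(r₊) = 0` then
`R ≡ 0` — unique continuation at the regular singular point `r₊` (exponents `−B(r₊)`, `+B(r₊)`;
`Re(−B(r₊)) ≥ 0` for `Im ω ≥ 0`) followed by Grönwall uniqueness along the exterior.
[cite: CasalsTeixeiradacosta2022, Theorem 3.10 (proof, Step 1)] -/
theorem masterRadial_zero_eq_zero_of_eventAmplitude_eq_zero {M a Λ μ : ℝ} {ω : ℂ} {m : ℝ}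
    {lamBar : ℂ} (hsub : IsSubextremal M a Λ) (hω : 0 ≤ ω.im) {R : ℝ → ℂ}
    (hR : IsMasterRadialSolution M a Λ 0 μ ω m lamBar R) {ε : ℝ} (hε : 0 < ε) {f : ℝ → ℂ}
    (hf : ContDiffOn ℝ ((⊤ : ℕ∞) : WithTop ℕ∞) f (Ioo (rPlus M a Λ - ε) (rPlus M a Λ + ε)))
    (hRf : ∀ r ∈ Ioo (rPlus M a Λ) (rPlus M a Λ + ε),
      R r * ((r - rPlus M a Λ : ℝ) : ℂ) ^ horizonB M a Λ ω m (rPlus M a Λ) = f r)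
    (hf0 : f (rPlus M a Λ) = 0) :
    ∀ r ∈ Ioo (rPlus M a Λ) (rCosmo M a Λ), R r = 0 := by
  have hd1 := deltaDeriv_rPlus_pos hsub
  obtain ⟨hM, hΛ, h01, h12, hΔ1, hΔ2, -, hΔpos, -⟩ := hsub
  have hξ : 0 < xi a Λ := xi_pos hΛ.le a
  have hr₁ : 0 < rPlus M a Λ := lt_of_le_of_lt (rMinus_nonneg M a Λ) h01
  set p := rPlus M a Λ with hp_def
  set z : ℂ := -horizonB M a Λ ω m p with hz_def
  have hz2 : z ^ 2 = -((xi a Λ : ℂ) ^ 2 * radialK a ω m p ^ 2 / (deltaDeriv M a Λ p : ℂ) ^ 2) := by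
    rw [hz_def, neg_sq, horizonB_sq]
  have hzre : 0 ≤ z.re := by
    rw [hz_def, neg_re, re_horizonB, neg_div, neg_neg]
    have hsq : 0 < p ^ 2 + a ^ 2 := add_pos_of_pos_of_nonneg (pow_pos hr₁ 2) (sq_nonneg a)
    exact div_nonneg (mul_nonneg (mul_pos hξ hsq).le hω) hd1.le
  obtain ⟨ε₁, hε₁, σ, P, Q, hΔσ, hσne, hPc, hQc, hPp, hPJ, hQJ⟩ :=
    exists_branchCoeffs M a Λ μ ω m lamBar hΔ1 hd1.ne' hz2
  obtain ⟨R', R'', hode⟩ := hR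
  -- the common neighbourhood
  set ε' : ℝ := min ε (min ε₁ (rCosmo M a Λ - p)) with hε'
  have hε'pos : 0 < ε' := lt_min hε (lt_min hε₁ (by linarith))
  have hε'ε : ε' ≤ ε := min_le_left _ _
  have hε'1 : ε' ≤ ε₁ := (min_le_right _ _).trans (min_le_left _ _)
  have hε'c : ε' ≤ rCosmo M a Λ - p := (min_le_right _ _).trans (min_le_right _ _)
  have hU1 : Ioo (p - ε') (p + ε') ⊆ Ioo (p - ε₁) (p + ε₁) := fun r hr =>
    ⟨by linarith [hr.1], by linarith [hr.2]⟩
  have hJ : ∀ r ∈ Ioo p (p + ε'), r ∈ Ioo (rPlus M a Λ) (rCosmo M a Λ) := fun r hr =>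
    ⟨hr.1, by linarith [hr.2]⟩
  obtain ⟨T, hT, hzero⟩ := eq_zero_near_of_cpowBranch_zero (x₀ := p) hε'pos (z := z)
    (ℓ := σ) (D := fun r => deltaDeriv M a Λ r)
    (V := fun r => masterRadialPotential M a Λ 0 μ ω m lamBar r) (f := f)
    (hf.mono fun r hr => ⟨by linarith [hr.1], by linarith [hr.2]⟩) hf0
    (R := R) (R' := R') (R'' := R'')
    (fun r hr => by
      obtain ⟨h1, h2, heq⟩ := hode r (hJ r hr)
      refine ⟨h1, h2, ?_⟩
      have hc : (delta M a Λ r : ℂ) = (σ r : ℂ) * ((r - p : ℝ) : ℂ) := by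
        rw [hΔσ r]; push_cast; ring
      rw [hc] at heq
      simpa using heq)
    (fun r hr => by
      have hx0 : (0 : ℝ) < r - p := by linarith [hr.1]
      have hne : ((r - p : ℝ) : ℂ) ≠ 0 := by exact_mod_cast hx0.ne'
      have h := hRf r ⟨hr.1, lt_of_lt_of_le hr.2 (by linarith)⟩
      have hpow : ((r - p : ℝ) : ℂ) ^ horizonB M a Λ ω m p ≠ 0 := by
        rw [Ne, cpow_eq_zero_iff, not_and_or]; exact Or.inl hne
      rw [hz_def, cpow_neg, ← h, mul_comm (R r) _, ← mul_assoc, inv_mul_cancel₀ hpow, one_mul])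
    (fun r hr => hσne r (hU1 ⟨by linarith [hr.1], hr.2⟩))
    (P := P) (Q := Q) (hPc.mono hU1) (hQc.mono hU1) (by rw [hPp]; linarith)
    (fun r hr => hPJ r (hU1 ⟨by linarith [hr.1], hr.2⟩))
    (fun r hr => hQJ r (hU1 ⟨by linarith [hr.1], hr.2⟩) (ne_of_gt hr.1))
  -- a point of the exterior with a neighbourhood where `R = 0`
  set r₁ : ℝ := p + min T ε' / 2 with hr₁_def
  have hmin : 0 < min T ε' := lt_min hT hε'pos
  have hr₁J : r₁ ∈ Ioo p (p + min T ε') := ⟨by linarith, by linarith⟩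
  have hr₁D : r₁ ∈ Ioo (rPlus M a Λ) (rCosmo M a Λ) :=
    hJ r₁ ⟨hr₁J.1, lt_of_lt_of_le hr₁J.2 (by linarith [min_le_right T ε'])⟩
  have hev : ∀ᶠ r in 𝓝 r₁, R r = 0 := by
    filter_upwards [isOpen_Ioo.mem_nhds hr₁J] with r hr
    exact hzero r ⟨hr.1, lt_of_lt_of_le hr.2 (by linarith [min_le_left T ε'])⟩
  exact masterRadial_eq_zero_of_eventuallyEq_zero (fun r hr => (hΔpos r hr).ne') ⟨R', R'', hode⟩
    hr₁D hev

/-- **An outgoing `s = 0` solution whose cosmological-horizon amplitude vanishes is identically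
zero** (`Im ω ≥ 0`): `R(r)(r_c − r)^{−B(r_c)} = g(r)` near `r_c` with `g` smooth, `g(r_c) = 0`
forces `R ≡ 0` on `(r₊, r_c)`. [cite: CasalsTeixeiradacosta2022, Theorem 3.10 (proof, Step 1)] -/
theorem masterRadial_zero_eq_zero_of_cosmoAmplitude_eq_zero {M a Λ μ : ℝ} {ω : ℂ} {m : ℝ}
    {lamBar : ℂ} (hsub : IsSubextremal M a Λ) (hω : 0 ≤ ω.im) {R : ℝ → ℂ}
    (hR : IsMasterRadialSolution M a Λ 0 μ ω m lamBar R) {ε : ℝ} (hε : 0 < ε) {g : ℝ → ℂ}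
    (hg : ContDiffOn ℝ ((⊤ : ℕ∞) : WithTop ℕ∞) g (Ioo (rCosmo M a Λ - ε) (rCosmo M a Λ + ε)))
    (hRg : ∀ r ∈ Ioo (rCosmo M a Λ - ε) (rCosmo M a Λ),
      R r * ((rCosmo M a Λ - r : ℝ) : ℂ) ^ (-horizonB M a Λ ω m (rCosmo M a Λ)) = g r)
    (hg0 : g (rCosmo M a Λ) = 0) :
    ∀ r ∈ Ioo (rPlus M a Λ) (rCosmo M a Λ), R r = 0 := by
  have hd2 := deltaDeriv_rCosmo_neg hsub
  obtain ⟨hM, hΛ, h01, h12, hΔ1, hΔ2, -, hΔpos, -⟩ := hsub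
  have hξ : 0 < xi a Λ := xi_pos hΛ.le a
  have hr₁ : 0 < rPlus M a Λ := lt_of_le_of_lt (rMinus_nonneg M a Λ) h01
  have hr₂ : 0 < rCosmo M a Λ := hr₁.trans h12
  set p := rCosmo M a Λ with hp_def
  set z : ℂ := horizonB M a Λ ω m p with hz_def
  have hz2 : z ^ 2 = -((xi a Λ : ℂ) ^ 2 * radialK a ω m p ^ 2 / (deltaDeriv M a Λ p : ℂ) ^ 2) := by
    rw [hz_def, horizonB_sq]
  have hzre : 0 ≤ z.re := by
    rw [hz_def, re_horizonB]
    have hsq : 0 < p ^ 2 + a ^ 2 := add_pos_of_pos_of_nonneg (pow_pos hr₂ 2) (sq_nonneg a)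
    have hnum : 0 ≤ xi a Λ * (p ^ 2 + a ^ 2) * ω.im := mul_nonneg (mul_pos hξ hsq).le hω
    exact div_nonneg_of_nonpos (by linarith) hd2.le
  obtain ⟨ε₁, hε₁, σ, P, Q, hΔσ, hσne, hPc, hQc, hPp, hPJ, hQJ⟩ :=
    exists_branchCoeffs M a Λ μ ω m lamBar hΔ2 hd2.ne hz2
  obtain ⟨R', R'', hode⟩ := hR
  set ε' : ℝ := min ε (min ε₁ (p - rPlus M a Λ)) with hε'
  have hε'pos : 0 < ε' := lt_min hε (lt_min hε₁ (by linarith))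
  have hε'ε : ε' ≤ ε := min_le_left _ _
  have hε'1 : ε' ≤ ε₁ := (min_le_right _ _).trans (min_le_left _ _)
  have hε'c : ε' ≤ p - rPlus M a Λ := (min_le_right _ _).trans (min_le_right _ _)
  have hU1 : Ioo (p - ε') (p + ε') ⊆ Ioo (p - ε₁) (p + ε₁) := fun r hr =>
    ⟨by linarith [hr.1], by linarith [hr.2]⟩
  have hJ : ∀ r ∈ Ioo (p - ε') p, r ∈ Ioo (rPlus M a Λ) (rCosmo M a Λ) := fun r hr =>
    ⟨by linarith [hr.1], hr.2⟩
  obtain ⟨T, hT, hzero⟩ := eq_zero_near_of_cpowBranch_zero_left (x₀ := p) hε'pos (z := z)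
    (ℓ := σ) (D := fun r => deltaDeriv M a Λ r)
    (V := fun r => masterRadialPotential M a Λ 0 μ ω m lamBar r) (f := g)
    (hg.mono fun r hr => ⟨by linarith [hr.1], by linarith [hr.2]⟩) hg0
    (R := R) (R' := R') (R'' := R'')
    (fun r hr => by
      obtain ⟨h1, h2, heq⟩ := hode r (hJ r hr)
      refine ⟨h1, h2, ?_⟩
      have hc : (delta M a Λ r : ℂ) = (σ r : ℂ) * ((r - p : ℝ) : ℂ) := by
        rw [hΔσ r]; push_cast; ring
      rw [hc] at heq
      simpa using heq)
    (fun r hr => by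
      have hx0 : (0 : ℝ) < p - r := by linarith [hr.2]
      have hne : ((p - r : ℝ) : ℂ) ≠ 0 := by exact_mod_cast hx0.ne'
      have h := hRg r ⟨lt_of_le_of_lt (by linarith) hr.1, hr.2⟩
      have hpow : ((p - r : ℝ) : ℂ) ^ horizonB M a Λ ω m p ≠ 0 := by
        rw [Ne, cpow_eq_zero_iff, not_and_or]; exact Or.inl hne
      rw [cpow_neg] at h
      rw [hz_def, ← h, mul_comm (R r) _, ← mul_assoc, mul_inv_cancel₀ hpow, one_mul])
    (fun r hr => hσne r (hU1 ⟨hr.1, by linarith [hr.2]⟩))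
    (P := P) (Q := Q) (hPc.mono hU1) (hQc.mono hU1) (by rw [hPp]; linarith)
    (fun r hr => hPJ r (hU1 ⟨hr.1, by linarith [hr.2]⟩))
    (fun r hr => hQJ r (hU1 ⟨hr.1, by linarith [hr.2]⟩) (ne_of_lt hr.2))
  set r₁ : ℝ := p - min T ε' / 2 with hr₁_def
  have hmin : 0 < min T ε' := lt_min hT hε'pos
  have hr₁J : r₁ ∈ Ioo (p - min T ε') p := ⟨by linarith, by linarith⟩
  have hr₁D : r₁ ∈ Ioo (rPlus M a Λ) (rCosmo M a Λ) :=
    hJ r₁ ⟨lt_of_le_of_lt (by linarith [min_le_right T ε']) hr₁J.1, hr₁J.2⟩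
  have hev : ∀ᶠ r in 𝓝 r₁, R r = 0 := by
    filter_upwards [isOpen_Ioo.mem_nhds hr₁J] with r hr
    exact hzero r ⟨lt_of_le_of_lt (by linarith [min_le_left T ε']) hr.1, hr.2⟩
  exact masterRadial_eq_zero_of_eventuallyEq_zero (fun r hr => (hΔpos r hr).ne') ⟨R', R'', hode⟩
    hr₁D hev


/-! ### Real frequencies: the Wronskian flux `Im(Δ_r R' R̄)` is conserved; the main theorem -/

/-- Imaginary part of `P|R'|² − V|R|²` for real `P`: `−|R|²·Im V` (pure algebra).
[cite: CasalsTeixeiradacosta2022, Theorem 3.10 (proof, Step 1)] -/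
theorem im_fluxDeriv_real (P : ℝ) (v z z' : ℂ) :
    ((P : ℂ) * (z' * conj z') - v * (z * conj z)).im = -(normSq z * v.im) := by
  rw [Complex.mul_conj, Complex.mul_conj]
  simp only [mul_im, sub_im, ofReal_re, ofReal_im]
  ring

/-- For `s = 0`, real `ω` and real `λ̄` the master radial coefficient is REAL on `{Δ_r ≠ 0}` ("the
potential is real if `ω` is real"). [cite: CasalsTeixeiradacosta2022, Theorem 3.10 (proof, Step 1)] -/
theorem im_masterRadialPotential_zero_of_real (M a Λ μ : ℝ) {ω : ℂ} (hω : ω.im = 0) (m : ℝ)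
    {lamBar : ℂ} (hlam : lamBar.im = 0) {r : ℝ} (hΔ : delta M a Λ r ≠ 0) :
    (masterRadialPotential M a Λ 0 μ ω m lamBar r).im = 0 := by
  rw [masterRadialPotential_zero_eq M a Λ μ ω m lamBar hΔ]
  simp [pow_two, hω, hlam]

/-- **Casals–Teixeira da Costa 2022, Theorem 3.10, real-frequency case for `s = 0` (Step 1 of the
printed proof, with the unique continuation it appeals to) — PROVED.** On subextremal Kerr–de Sitter
let `R` solve the `s = 0` radial master equation (any real Klein–Gordon parameter `μ`) with REAL
frequency `ω` and REAL separation constant `λ̄`, ingoing at `𝓗⁺` and outgoing at `𝓗⁺_c` (generic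
exponents). Printed: "if `Im ω = 0`, `0 = ω(ω−mϖ₁)|u(−∞)|² + ω(ω−mϖ₂)|u(+∞)|²` … If `ω ∈ ℝ` we cannot
argue just from [this]. As in the Kerr case, we need to appeal to unique continuation for ODEs such
as (3.9) to deduce that, unless the superradiant condition `m ≠ 0`, `ϖ₂ < ω/m < ϖ₁` holds, we may
infer that `u ≡ 0`". Here: if `(Re ω − mϖ₁)(Re ω − mϖ₂) ≥ 0` (NOT `ϖ₂ < ω/m < ϖ₁`) and
`(ω, am) ≠ (0, 0)` (the printed mode solutions have `ω ≠ 0`, Def. 3.4), then `R ≡ 0` on `(r₊, r_c)`.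
Mechanism: the coefficient is real, so the Wronskian flux `G = Im(Δ_r R' R̄)` is constant on
`(r₊, r_c)`; its horizon limits are `−Ξ Re K(r₊)|f(r₊)|²` and `+Ξ Re K(r_c)|g(r_c)|²`
(`Re K(r_h) = (Re ω − mϖ_h)(r_h² + a²)`, `f`, `g` the smooth branch amplitudes), so under the sign
hypothesis one amplitude vanishes, and then `R ≡ 0` by unique continuation at that horizon
(`masterRadial_zero_eq_zero_of_eventAmplitude_eq_zero` / `…_of_cosmoAmplitude_eq_zero`).
[cite: CasalsTeixeiradacosta2022, Theorem 3.10 (proof, Step 1)] -/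
theorem masterRadial_zero_real_eq_zero {M a Λ μ : ℝ} {ω : ℂ} {m : ℝ} {lamBar : ℂ}
    (hsub : IsSubextremal M a Λ) (hω : ω.im = 0) (hlam : lamBar.im = 0)
    (hK : ω ≠ 0 ∨ a * m ≠ 0)
    (hSR : 0 ≤ (ω.re - m * horizonAngVel a (rPlus M a Λ)) *
      (ω.re - m * horizonAngVel a (rCosmo M a Λ)))
    {R : ℝ → ℂ} (hR : IsMasterRadialSolution M a Λ 0 μ ω m lamBar R)
    (hin : IsIngoingAtEventHorizon M a Λ 0 ω m R) (hout : IsOutgoingAtCosmoHorizon M a Λ ω m R) :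
    ∀ r ∈ Ioo (rPlus M a Λ) (rCosmo M a Λ), R r = 0 := by
  have hd1 := deltaDeriv_rPlus_pos hsub
  have hd2 := deltaDeriv_rCosmo_neg hsub
  have hsub' := hsub
  obtain ⟨hM, hΛ, h01, h12, hΔ1, hΔ2, -, hΔpos, -⟩ := hsub
  have hξ : 0 < xi a Λ := xi_pos hΛ.le a
  have hr₁ : 0 < rPlus M a Λ := lt_of_le_of_lt (rMinus_nonneg M a Λ) h01
  have hr₂ : 0 < rCosmo M a Λ := hr₁.trans h12
  have hωim : 0 ≤ ω.im := le_of_eq hω.symm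
  obtain ⟨R', R'', hode⟩ := id hR
  obtain ⟨ε₁, hε₁, f, hf, hRf⟩ := hin
  obtain ⟨ε₂, hε₂, g, hg, hRg⟩ := hout
  have hRf' : ∀ r ∈ Ioo (rPlus M a Λ) (rPlus M a Λ + ε₁),
      R r * ((r - rPlus M a Λ : ℝ) : ℂ) ^ horizonB M a Λ ω m (rPlus M a Λ) = f r := by
    intro r hr
    have h := hRf r hr
    simpa only [ofReal_zero, zero_add] using h
  set K₁ : ℝ := (radialK a ω m (rPlus M a Λ)).re with hK₁
  set K₂ : ℝ := (radialK a ω m (rCosmo M a Λ)).re with hK₂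
  -- the flux `G = Im(Δ R' conj R)` has zero derivative on the exterior (real coefficient)
  set G : ℝ → ℝ := fun r => ((delta M a Λ r : ℂ) * R' r * conj (R r)).im with hG
  have hGd : ∀ r ∈ Ioo (rPlus M a Λ) (rCosmo M a Λ), HasDerivAt G 0 r := by
    intro r hr
    obtain ⟨h1, h2, heq⟩ := hode r hr
    have hΔd : HasDerivAt (fun y => (delta M a Λ y : ℂ)) ((deltaDeriv M a Λ r : ℝ) : ℂ) r :=
      (hasDerivAt_delta M a Λ r).ofReal_comp
    have hRbar : HasDerivAt (fun y => conj (R y)) (conj (R' r)) r := by simpa using h1.star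
    have hprod := (hΔd.fun_mul h2).fun_mul hRbar
    have heq' : (delta M a Λ r : ℂ) * R'' r + (deltaDeriv M a Λ r : ℂ) * R' r =
        -(masterRadialPotential M a Λ 0 μ ω m lamBar r * R r) := by
      have h := heq
      simp only [zero_add, ofReal_one, one_mul] at h
      linear_combination h
    have hF : HasDerivAt (fun y => (delta M a Λ y : ℂ) * R' y * conj (R y))
        ((delta M a Λ r : ℂ) * (R' r * conj (R' r)) -
          masterRadialPotential M a Λ 0 μ ω m lamBar r * (R r * conj (R r))) r := by
      refine hprod.congr_deriv ?_
      linear_combination conj (R r) * heq'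
    have hval : ((delta M a Λ r : ℂ) * (R' r * conj (R' r)) -
        masterRadialPotential M a Λ 0 μ ω m lamBar r * (R r * conj (R r))).im = 0 := by
      rw [im_fluxDeriv_real, im_masterRadialPotential_zero_of_real M a Λ μ hω m hlam (hΔpos r hr).ne']
      ring
    have hG' : HasDerivAt G (((delta M a Λ r : ℂ) * (R' r * conj (R' r)) -
        masterRadialPotential M a Λ 0 μ ω m lamBar r * (R r * conj (R r))).im) r := by
      simpa only [Function.comp_def, Complex.imCLM_apply] using
        (Complex.imCLM.hasFDerivAt.comp_hasDerivAt r hF)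
    rw [hval] at hG'
    exact hG'
  -- the limit of `G` at `r₊`: `−Ξ Re K(r₊) |f(r₊)|²`
  have hB1re : (-horizonB M a Λ ω m (rPlus M a Λ)).re = 0 := by
    rw [neg_re, re_horizonB, hω]; simp
  have hb₁ : rPlus M a Λ < min (rPlus M a Λ + ε₁) (rCosmo M a Λ) := lt_min (by linarith) h12
  have hJ₁sub : Ioo (rPlus M a Λ) (min (rPlus M a Λ + ε₁) (rCosmo M a Λ)) ⊆
      Ioo (rPlus M a Λ - ε₁) (rPlus M a Λ + ε₁) := fun x hx =>
    ⟨by linarith [hx.1], lt_of_lt_of_le hx.2 (min_le_left _ _)⟩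
  have hflux₁ := tendsto_boundaryFlux_of_cpowBranch_of_re_eq_zero (x₀ := rPlus M a Λ)
    (U := Ioo (rPlus M a Λ - ε₁) (rPlus M a Λ + ε₁))
    (J := Ioo (rPlus M a Λ) (min (rPlus M a Λ + ε₁) (rCosmo M a Λ))) isOpen_Ioo
    ⟨by linarith, by linarith⟩ isOpen_Ioo hJ₁sub hf
    (u := fun x => x - rPlus M a Λ) (c := 1) (fun x => (hasDerivAt_id' x).sub_const _) (by simp)
    (fun x hx => by simp only [sub_pos]; exact hx.1) hB1re (S := R) (S' := R')
    (fun x hx => (hode x ⟨hx.1, lt_of_lt_of_le hx.2 (min_le_right _ _)⟩).1)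
    (fun x hx => by
      have hx0 : (0 : ℝ) < x - rPlus M a Λ := by linarith [hx.1]
      have hne : ((x - rPlus M a Λ : ℝ) : ℂ) ≠ 0 := by exact_mod_cast hx0.ne'
      have h := hRf' x ⟨hx.1, lt_of_lt_of_le hx.2 (min_le_left _ _)⟩
      have hpow : ((x - rPlus M a Λ : ℝ) : ℂ) ^ horizonB M a Λ ω m (rPlus M a Λ) ≠ 0 := by
        rw [Ne, cpow_eq_zero_iff, not_and_or]; exact Or.inl hne
      rw [cpow_neg, ← h, mul_comm (R x) _, ← mul_assoc, inv_mul_cancel₀ hpow, one_mul])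
  have hslope₁ : Tendsto (slope (delta M a Λ) (rPlus M a Λ))
      (𝓝[Ioo (rPlus M a Λ) (min (rPlus M a Λ + ε₁) (rCosmo M a Λ))] (rPlus M a Λ))
      (𝓝 (deltaDeriv M a Λ (rPlus M a Λ))) :=
    ((hasDerivAt_iff_tendsto_slope).1 (hasDerivAt_delta M a Λ (rPlus M a Λ))).mono_left
      (nhdsWithin_mono _ fun x hx => ne_of_gt hx.1)
  set L₁ : ℝ := (((deltaDeriv M a Λ (rPlus M a Λ) : ℝ) : ℂ) *
      (-horizonB M a Λ ω m (rPlus M a Λ) * ((1 : ℝ) : ℂ) *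
        (f (rPlus M a Λ) * conj (f (rPlus M a Λ))))).im with hL₁
  have hlim₁ : Tendsto G (𝓝[>] rPlus M a Λ) (𝓝 L₁) := by
    have h := (Complex.continuous_im.tendsto _).comp (hslope₁.ofReal.mul hflux₁)
    rw [nhdsWithin_Ioo_eq_nhdsGT hb₁] at h
    refine h.congr' ?_
    filter_upwards [Ioo_mem_nhdsGT hb₁] with x hx
    have hx0 : x - rPlus M a Λ ≠ 0 := by linarith [hx.1]
    have hsl : slope (delta M a Λ) (rPlus M a Λ) x * (x - rPlus M a Λ) = delta M a Λ x := by
      rw [slope_def_field, hΔ1, sub_zero, div_mul_cancel₀ _ hx0]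
    simp only [hG, Function.comp_def]
    rw [← hsl]
    congr 1
    push_cast
    ring
  have hL₁val : L₁ = -(xi a Λ * K₁ * normSq (f (rPlus M a Λ))) := by
    rw [hL₁, Complex.mul_conj, hK₁]
    simp only [mul_im, mul_re, ofReal_re, ofReal_im, neg_re, neg_im, ofReal_one,
      mul_zero, mul_one, zero_mul, add_zero, sub_zero, zero_add, im_horizonB]
    field_simp
  -- the limit of `G` at `r_c`: `+Ξ Re K(r_c) |g(r_c)|²`
  have hB2re : (horizonB M a Λ ω m (rCosmo M a Λ)).re = 0 := by
    rw [re_horizonB, hω]; simp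
  have hb₂ : max (rCosmo M a Λ - ε₂) (rPlus M a Λ) < rCosmo M a Λ := max_lt (by linarith) h12
  have hJ₂sub : Ioo (max (rCosmo M a Λ - ε₂) (rPlus M a Λ)) (rCosmo M a Λ) ⊆
      Ioo (rCosmo M a Λ - ε₂) (rCosmo M a Λ + ε₂) := fun x hx =>
    ⟨lt_of_le_of_lt (le_max_left _ _) hx.1, by linarith [hx.2]⟩
  have hflux₂ := tendsto_boundaryFlux_of_cpowBranch_of_re_eq_zero (x₀ := rCosmo M a Λ)
    (U := Ioo (rCosmo M a Λ - ε₂) (rCosmo M a Λ + ε₂))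
    (J := Ioo (max (rCosmo M a Λ - ε₂) (rPlus M a Λ)) (rCosmo M a Λ)) isOpen_Ioo
    ⟨by linarith, by linarith⟩ isOpen_Ioo hJ₂sub hg
    (u := fun x => rCosmo M a Λ - x) (c := -1) (fun x => (hasDerivAt_id' x).const_sub _)
    (by simp) (fun x hx => by simp only [sub_pos]; exact hx.2) hB2re (S := R) (S' := R')
    (fun x hx => (hode x ⟨lt_of_le_of_lt (le_max_right _ _) hx.1, hx.2⟩).1)
    (fun x hx => by
      have hx0 : (0 : ℝ) < rCosmo M a Λ - x := by linarith [hx.2]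
      have hne : ((rCosmo M a Λ - x : ℝ) : ℂ) ≠ 0 := by exact_mod_cast hx0.ne'
      have h := hRg x ⟨lt_of_le_of_lt (le_max_left _ _) hx.1, hx.2⟩
      have hpow : ((rCosmo M a Λ - x : ℝ) : ℂ) ^ horizonB M a Λ ω m (rCosmo M a Λ) ≠ 0 := by
        rw [Ne, cpow_eq_zero_iff, not_and_or]; exact Or.inl hne
      rw [cpow_neg] at h
      rw [← h, mul_comm (R x) _, ← mul_assoc, mul_inv_cancel₀ hpow, one_mul])
  have hslope₂ : Tendsto (slope (delta M a Λ) (rCosmo M a Λ))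
      (𝓝[Ioo (max (rCosmo M a Λ - ε₂) (rPlus M a Λ)) (rCosmo M a Λ)] (rCosmo M a Λ))
      (𝓝 (deltaDeriv M a Λ (rCosmo M a Λ))) :=
    ((hasDerivAt_iff_tendsto_slope).1 (hasDerivAt_delta M a Λ (rCosmo M a Λ))).mono_left
      (nhdsWithin_mono _ fun x hx => ne_of_lt hx.2)
  set L₂ : ℝ := (-((deltaDeriv M a Λ (rCosmo M a Λ) : ℝ) : ℂ) *
      (horizonB M a Λ ω m (rCosmo M a Λ) * ((-1 : ℝ) : ℂ) *
        (g (rCosmo M a Λ) * conj (g (rCosmo M a Λ))))).im with hL₂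
  have hlim₂ : Tendsto G (𝓝[<] rCosmo M a Λ) (𝓝 L₂) := by
    have h := (Complex.continuous_im.tendsto _).comp (hslope₂.ofReal.neg.mul hflux₂)
    rw [nhdsWithin_Ioo_eq_nhdsLT hb₂] at h
    refine h.congr' ?_
    filter_upwards [Ioo_mem_nhdsLT hb₂] with x hx
    have hx0 : x - rCosmo M a Λ ≠ 0 := by linarith [hx.2]
    have hsl : slope (delta M a Λ) (rCosmo M a Λ) x * (x - rCosmo M a Λ) = delta M a Λ x := by
      rw [slope_def_field, hΔ2, sub_zero, div_mul_cancel₀ _ hx0]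
    simp only [hG, Function.comp_def]
    rw [← hsl]
    congr 1
    push_cast
    ring
  have hL₂val : L₂ = xi a Λ * K₂ * normSq (g (rCosmo M a Λ)) := by
    have hd2ne : deltaDeriv M a Λ (rCosmo M a Λ) ≠ 0 := hd2.ne
    rw [hL₂, Complex.mul_conj, hK₂]
    simp only [mul_im, mul_re, ofReal_re, ofReal_im, ofReal_one,
      ofReal_neg, mul_zero, mul_one, zero_mul, add_zero, sub_zero, zero_add, im_horizonB,
      mul_neg, neg_mul, neg_neg]
    field_simp
  -- the flux is conserved: `L₁ = L₂` (Cauchy mean value theorem with endpoint limits)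
  have hLeq : L₁ = L₂ := by
    obtain ⟨c, -, hc⟩ := exists_ratio_hasDerivAt_eq_ratio_slope' (f := G)
      (f' := fun _ => (0 : ℝ)) h12 (g := id) (g' := fun _ => (1 : ℝ))
      (lfa := L₁) (lga := rPlus M a Λ) (lfb := L₂) (lgb := rCosmo M a Λ)
      (fun x hx => hGd x hx) (fun x _ => hasDerivAt_id x) hlim₁
      ((continuous_id.tendsto _).mono_left nhdsWithin_le_nhds) hlim₂
      ((continuous_id.tendsto _).mono_left nhdsWithin_le_nhds)
    simp only [mul_zero, mul_one] at hc
    linarith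
  -- the boundary identity `Re K(r₊)|f(r₊)|² + Re K(r_c)|g(r_c)|² = 0`
  have hid : K₁ * normSq (f (rPlus M a Λ)) + K₂ * normSq (g (rCosmo M a Λ)) = 0 := by
    have h := hLeq
    rw [hL₁val, hL₂val] at h
    have h2 : xi a Λ * (K₁ * normSq (f (rPlus M a Λ)) + K₂ * normSq (g (rCosmo M a Λ))) = 0 := by
      linarith
    exact (mul_eq_zero.1 h2).resolve_left hξ.ne'
  have hX : 0 ≤ normSq (f (rPlus M a Λ)) := normSq_nonneg _
  have hY : 0 ≤ normSq (g (rCosmo M a Λ)) := normSq_nonneg _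
  -- `Re K(r_h) = (Re ω − mϖ_h)(r_h² + a²)`
  have hsq1 : 0 < rPlus M a Λ ^ 2 + a ^ 2 := add_pos_of_pos_of_nonneg (pow_pos hr₁ 2) (sq_nonneg a)
  have hsq2 : 0 < rCosmo M a Λ ^ 2 + a ^ 2 := add_pos_of_pos_of_nonneg (pow_pos hr₂ 2) (sq_nonneg a)
  have hK₁eq : K₁ = (ω.re - m * horizonAngVel a (rPlus M a Λ)) * (rPlus M a Λ ^ 2 + a ^ 2) := by
    rw [hK₁, re_radialK, horizonAngVel]
    field_simp
  have hK₂eq : K₂ = (ω.re - m * horizonAngVel a (rCosmo M a Λ)) * (rCosmo M a Λ ^ 2 + a ^ 2) := by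
    rw [hK₂, re_radialK, horizonAngVel]
    field_simp
  have hprod : 0 ≤ K₁ * K₂ := by
    have h : K₁ * K₂ = ((ω.re - m * horizonAngVel a (rPlus M a Λ)) *
        (ω.re - m * horizonAngVel a (rCosmo M a Λ))) *
        ((rPlus M a Λ ^ 2 + a ^ 2) * (rCosmo M a Λ ^ 2 + a ^ 2)) := by
      rw [hK₁eq, hK₂eq]; ring
    rw [h]
    exact mul_nonneg hSR (mul_pos hsq1 hsq2).le
  have hnotboth : ¬(K₁ = 0 ∧ K₂ = 0) := by
    rintro ⟨h1, h2⟩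
    have e1 : K₁ - K₂ = ω.re * (rPlus M a Λ ^ 2 - rCosmo M a Λ ^ 2) := by
      rw [hK₁, hK₂, re_radialK, re_radialK]; ring
    rw [h1, h2, sub_self] at e1
    have hlt : rPlus M a Λ ^ 2 < rCosmo M a Λ ^ 2 := by
      rw [pow_two, pow_two]; exact mul_lt_mul'' h12 h12 hr₁.le hr₁.le
    have hsq : rPlus M a Λ ^ 2 - rCosmo M a Λ ^ 2 ≠ 0 := by linarith
    have hωre : ω.re = 0 := (mul_eq_zero.1 e1.symm).resolve_right hsq
    have hω0 : ω = 0 := Complex.ext hωre hω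
    rcases hK with hne | hne
    · exact hne hω0
    · apply hne
      have h3 : K₁ = -(a * m) := by rw [hK₁, re_radialK, hωre]; ring
      linarith
  by_cases hK₁0 : K₁ = 0
  · -- then `Re K(r_c) ≠ 0` and the cosmological amplitude vanishes
    have hK₂0 : K₂ ≠ 0 := fun h => hnotboth ⟨hK₁0, h⟩
    have hY0 : normSq (g (rCosmo M a Λ)) = 0 := by
      rw [hK₁0, zero_mul, zero_add] at hid
      exact (mul_eq_zero.1 hid).resolve_left hK₂0
    have hg0 : g (rCosmo M a Λ) = 0 := Complex.normSq_eq_zero.1 hY0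
    exact masterRadial_zero_eq_zero_of_cosmoAmplitude_eq_zero hsub' hωim hR hε₂ hg hRg hg0
  · -- `Re K(r₊) ≠ 0`: the event-horizon amplitude vanishes
    have hX0 : normSq (f (rPlus M a Λ)) = 0 := by
      have h1 : K₁ ^ 2 * normSq (f (rPlus M a Λ)) = -(K₁ * K₂) * normSq (g (rCosmo M a Λ)) := by
        linear_combination K₁ * hid
      have h2 : K₁ ^ 2 * normSq (f (rPlus M a Λ)) ≤ 0 := by
        rw [h1]
        have h4 := mul_nonneg hprod hY
        linarith
      have h3 : 0 < K₁ ^ 2 := by positivity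
      by_contra hX0
      have h5 : 0 < normSq (f (rPlus M a Λ)) := lt_of_le_of_ne hX (Ne.symm hX0)
      have h6 := mul_pos h3 h5
      linarith
    have hf0 : f (rPlus M a Λ) = 0 := Complex.normSq_eq_zero.1 hX0
    exact masterRadial_zero_eq_zero_of_eventAmplitude_eq_zero hsub' hωim hR hε₁ hf hRf' hf0

/-- **Real-frequency `s = 0` modes are superradiant** (contrapositive of
`masterRadial_zero_real_eq_zero`): on subextremal Kerr–de Sitter, a NON-TRIVIAL solution of the
`s = 0` radial master equation with real `ω`, real `λ̄`, `(ω, am) ≠ (0,0)`, ingoing at `𝓗⁺` and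
outgoing at `𝓗⁺_c`, satisfies `(Re ω − mϖ₁)(Re ω − mϖ₂) < 0` — the printed "superradiant condition
`m ≠ 0`, `ϖ₂ < ω/m < ϖ₁`". [cite: CasalsTeixeiradacosta2022, Theorem 3.10 (proof, Step 1)] -/
theorem masterMode_zero_real_superradiant {M a Λ μ : ℝ} {ω : ℂ} {m : ℝ} {lamBar : ℂ}
    {R : ℝ → ℂ} (hsub : IsSubextremal M a Λ) (hω : ω.im = 0) (hlam : lamBar.im = 0)
    (hK : ω ≠ 0 ∨ a * m ≠ 0) (hR : IsMasterRadialSolution M a Λ 0 μ ω m lamBar R)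
    (hin : IsIngoingAtEventHorizon M a Λ 0 ω m R) (hout : IsOutgoingAtCosmoHorizon M a Λ ω m R)
    (hnt : ∃ r ∈ Ioo (rPlus M a Λ) (rCosmo M a Λ), R r ≠ 0) :
    (ω.re - m * horizonAngVel a (rPlus M a Λ)) * (ω.re - m * horizonAngVel a (rCosmo M a Λ)) < 0 := by
  by_contra h
  rw [not_lt] at h
  obtain ⟨r, hr, hne⟩ := hnt
  exact hne (masterRadial_zero_real_eq_zero hsub hω hlam hK h hR hin hout r hr)

/-- The same window in the printed form `m ≠ 0`, `ϖ₂ < ω/m < ϖ₁` (for `a ≥ 0`, where `ϖ₂ ≤ ϖ₁`;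
`ϖ₁ = a/(r₊²+a²)`, `ϖ₂ = a/(r_c²+a²)`), for a non-trivial real-frequency (`ω ≠ 0`) `s = 0` solution
with real `λ̄`. [cite: CasalsTeixeiradacosta2022, Theorem 3.10 (proof, Step 1)] -/
theorem masterMode_zero_real_window {M a Λ μ : ℝ} {ω : ℂ} {m : ℝ} {lamBar : ℂ}
    {R : ℝ → ℂ} (hsub : IsSubextremal M a Λ) (ha : 0 ≤ a) (hω : ω.im = 0) (hω0 : ω ≠ 0)
    (hlam : lamBar.im = 0) (hR : IsMasterRadialSolution M a Λ 0 μ ω m lamBar R)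
    (hin : IsIngoingAtEventHorizon M a Λ 0 ω m R) (hout : IsOutgoingAtCosmoHorizon M a Λ ω m R)
    (hnt : ∃ r ∈ Ioo (rPlus M a Λ) (rCosmo M a Λ), R r ≠ 0) :
    m ≠ 0 ∧ horizonAngVel a (rCosmo M a Λ) < ω.re / m ∧
      ω.re / m < horizonAngVel a (rPlus M a Λ) := by
  have h := masterMode_zero_real_superradiant hsub hω hlam (Or.inl hω0) hR hin hout hnt
  obtain ⟨hM, hΛ, h01, h12, -⟩ := hsub
  have hr₁ : 0 < rPlus M a Λ := lt_of_le_of_lt (rMinus_nonneg M a Λ) h01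
  have hsq1 : 0 < rPlus M a Λ ^ 2 + a ^ 2 := add_pos_of_pos_of_nonneg (pow_pos hr₁ 2) (sq_nonneg a)
  have hle : horizonAngVel a (rCosmo M a Λ) ≤ horizonAngVel a (rPlus M a Λ) := by
    unfold horizonAngVel
    exact div_le_div_of_nonneg_left ha hsq1 (by nlinarith)
  set w₁ := horizonAngVel a (rPlus M a Λ) with hw₁
  set w₂ := horizonAngVel a (rCosmo M a Λ) with hw₂
  have hm : m ≠ 0 := by
    rintro rfl
    simp only [zero_mul, sub_zero] at h
    nlinarith
  have hm2 : 0 < m ^ 2 := by positivity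
  set x : ℝ := ω.re / m with hx
  have hxm : ω.re = x * m := by rw [hx]; field_simp
  rw [hxm] at h
  have h' : (x - w₁) * (x - w₂) < 0 := by
    have e : (x * m - m * w₁) * (x * m - m * w₂) = m ^ 2 * ((x - w₁) * (x - w₂)) := by ring
    rw [e] at h
    exact (mul_neg_iff.1 (show m ^ 2 * ((x - w₁) * (x - w₂)) < 0 from h)).elim
      (fun hh => hh.2) (fun hh => absurd hh.1 (not_lt.2 hm2.le))
  refine ⟨hm, ?_, ?_⟩
  · by_contra hc
    rw [not_lt] at hc
    have h1 : x - w₂ ≤ 0 := by linarith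
    have h2 : x - w₁ ≤ 0 := by linarith
    nlinarith
  · by_contra hc
    rw [not_lt] at hc
    have h1 : 0 ≤ x - w₁ := by linarith
    have h2 : 0 ≤ x - w₂ := by linarith
    nlinarith

/-- **No real-frequency `s = 0` master mode outside the superradiant interval** (any real
Klein–Gordon parameter `μ`, e.g. the massless wave equation `μ = 0` and the conformal scalar
`μ = 1`): on subextremal Kerr–de Sitter there is no mode of the `s = 0` master system with
`Im ω = 0`, `ω ≠ 0` and `(Re ω − mϖ₁)(Re ω − mϖ₂) ≥ 0`. Unconditional: the reality of the angular
eigenvalue is `masterAngularEigenvalue_real`. This is the real-axis ("(MS)"-type) statement for the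
Klein–Gordon radial ODE outside `ϖ₂ < ω/m < ϖ₁`.
[cite: CasalsTeixeiradacosta2022, Theorem 3.10 (proof, Step 1)] -/
theorem noMasterModeIn_zero_realAxis {M a Λ : ℝ} (hsub : IsSubextremal M a Λ) (μ : ℝ) :
    NoMasterModeIn M a Λ 0 μ
      {q | q.1.im = 0 ∧ q.1 ≠ 0 ∧ 0 ≤ (q.1.re - q.2 * horizonAngVel a (rPlus M a Λ)) *
        (q.1.re - q.2 * horizonAngVel a (rCosmo M a Λ))} := by
  intro ω m hq _ hmode
  obtain ⟨hω, hω0, hSR⟩ := hq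
  dsimp only at hω hω0 hSR
  obtain ⟨lamBar, R, hang, hR, hin, hout, hnt⟩ := hmode
  have hν : ((a : ℂ) * ω).im = 0 := by
    rw [mul_im, ofReal_re, ofReal_im, hω]; ring
  have hlam : lamBar.im = 0 := masterAngularEigenvalue_real hν hang
  obtain ⟨r, hr, hne⟩ := hnt
  exact hne (masterRadial_zero_real_eq_zero hsub hω hlam (Or.inl hω0) hSR hR hin hout r hr)

/-- Pointwise form: for real `ω ≠ 0` with `(Re ω − mϖ₁)(Re ω − mϖ₂) ≥ 0` there is no `s = 0` master
mode (any real `μ`). [cite: CasalsTeixeiradacosta2022, Theorem 3.10 (proof, Step 1)] -/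
theorem not_hasMasterMode_zero_real {M a Λ μ : ℝ} {ω : ℂ} {m : ℝ} (hsub : IsSubextremal M a Λ)
    (hω : ω.im = 0) (hω0 : ω ≠ 0)
    (hSR : 0 ≤ (ω.re - m * horizonAngVel a (rPlus M a Λ)) *
      (ω.re - m * horizonAngVel a (rCosmo M a Λ))) :
    ¬HasMasterMode M a Λ 0 μ ω m := by
  intro hmode
  obtain ⟨lamBar, R, hang, hR, hin, hout, hnt⟩ := hmode
  have hν : ((a : ℂ) * ω).im = 0 := by
    rw [mul_im, ofReal_re, ofReal_im, hω]; ring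
  have hlam : lamBar.im = 0 := masterAngularEigenvalue_real hν hang
  obtain ⟨r, hr, hne⟩ := hnt
  exact hne (masterRadial_zero_real_eq_zero hsub hω hlam (Or.inl hω0) hSR hR hin hout r hr)

/-- **Axisymmetric real-frequency `s = 0` modes do not exist** (`m = 0`, `ω ∈ ℝ ∖ {0}`, any real `μ`):
the superradiant interval is empty for `m = 0`. [cite: CasalsTeixeiradacosta2022, Theorem 3.10 (proof, Step 1)] -/
theorem not_hasMasterMode_zero_real_of_m_zero {M a Λ μ : ℝ} {ω : ℂ} (hsub : IsSubextremal M a Λ)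
    (hω : ω.im = 0) (hω0 : ω ≠ 0) : ¬HasMasterMode M a Λ 0 μ ω 0 :=
  not_hasMasterMode_zero_real hsub hω hω0 (by
    simp only [zero_mul, sub_zero]
    exact mul_self_nonneg _)

/-- Teukolsky form (`μ = 1`, the `s = 0` modes `HasMode M a Λ 0 ω m` of
`KerrDeSitterTeukolskyRadial.lean`): **no real-frequency conformal-scalar mode outside the
superradiant interval** — `NoModeIn` on `{Im ω = 0, ω ≠ 0, (Re ω − mϖ₁)(Re ω − mϖ₂) ≥ 0}`,
unconditionally on every subextremal Kerr–de Sitter. Together with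
`noModeIn_zero_superradiantComplement'` (`Im ω > 0`) this is the whole of Step 1 of the printed
proof for `s = 0`. [cite: CasalsTeixeiradacosta2022, Theorem 3.10 (proof, Step 1)] -/
theorem noModeIn_zero_realAxis {M a Λ : ℝ} (hsub : IsSubextremal M a Λ) :
    NoModeIn M a Λ 0
      {q | q.1.im = 0 ∧ q.1 ≠ 0 ∧ 0 ≤ (q.1.re - q.2 * horizonAngVel a (rPlus M a Λ)) *
        (q.1.re - q.2 * horizonAngVel a (rCosmo M a Λ))} :=
  (noMasterModeIn_one_iff M a Λ 0 hsub.2.1.le _).1 (noMasterModeIn_zero_realAxis hsub 1)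

/-- Pointwise Teukolsky form: no `s = 0` mode `HasMode M a Λ 0 ω m` with real `ω ≠ 0` outside the
superradiant interval. [cite: CasalsTeixeiradacosta2022, Theorem 3.10 (proof, Step 1)] -/
theorem not_hasMode_zero_real {M a Λ : ℝ} {ω : ℂ} {m : ℝ} (hsub : IsSubextremal M a Λ)
    (hω : ω.im = 0) (hω0 : ω ≠ 0)
    (hSR : 0 ≤ (ω.re - m * horizonAngVel a (rPlus M a Λ)) *
      (ω.re - m * horizonAngVel a (rCosmo M a Λ))) :
    ¬HasMode M a Λ 0 ω m := by
  rw [← hasMasterMode_one_iff M a Λ 0 hsub.2.1.le]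
  exact not_hasMasterMode_zero_real hsub hω hω0 hSR

/-! ### The zero frequency `ω = 0` for `m ≠ 0`, `a ≠ 0` (same identity: `K = −am ≠ 0`) -/

/-- **No zero-frequency `s = 0` mode with `m ≠ 0` on rotating subextremal Kerr–de Sitter** (any real
`μ`). The printed boundary-pairing identity of Step 1 does not need `ω ≠ 0` but only
`K(r_h) = ω(r_h² + a²) − am ≠ 0`, i.e. `(ω, am) ≠ (0, 0)` (`masterRadial_zero_real_eq_zero`, hypothesis
`hK`); at `ω = 0` the sign condition reads `m²ϖ₁ϖ₂ ≥ 0`, which always holds (`ϖ_h = a/(r_h² + a²)`).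
So for `a ≠ 0`, `m ≠ 0` there is no `s = 0` master mode at `ω = 0` either — the point `ω = 0` left
open by `noMasterModeIn_zero_realAxis` is a residual only for `m = 0` (where, for `μ = 0`, the
constants ARE zero-frequency solutions). CTdC's Definition 3.4 itself excludes `ω = 0`; this is the
same Step-1 argument read at `ω = 0`. [cite: CasalsTeixeiradacosta2022, Theorem 3.10 (proof, Step 1)] -/
theorem not_hasMasterMode_zero_omega_zero {M a Λ μ : ℝ} {m : ℝ} (hsub : IsSubextremal M a Λ)
    (ha : a ≠ 0) (hm : m ≠ 0) : ¬HasMasterMode M a Λ 0 μ 0 m := by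
  intro hmode
  obtain ⟨lamBar, R, hang, hR, hin, hout, hnt⟩ := hmode
  have hν : ((a : ℂ) * 0).im = 0 := by simp
  have hlam : lamBar.im = 0 := masterAngularEigenvalue_real hν hang
  have hϖ : 0 ≤ horizonAngVel a (rPlus M a Λ) * horizonAngVel a (rCosmo M a Λ) := by
    unfold horizonAngVel
    rw [div_mul_div_comm]
    exact div_nonneg (by nlinarith) (by positivity)
  have hSR : 0 ≤ ((0 : ℂ).re - m * horizonAngVel a (rPlus M a Λ)) *
      ((0 : ℂ).re - m * horizonAngVel a (rCosmo M a Λ)) := by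
    rw [Complex.zero_re, zero_sub, zero_sub, neg_mul_neg]
    nlinarith [sq_nonneg m]
  obtain ⟨r, hr, hne⟩ := hnt
  exact hne (masterRadial_zero_real_eq_zero hsub (by simp) hlam (Or.inr (mul_ne_zero ha hm)) hSR
    hR hin hout r hr)

/-- Window form: for `a ≠ 0` there is no `s = 0` master mode on `{ω = 0, m ≠ 0}` (any real `μ`).
[cite: CasalsTeixeiradacosta2022, Theorem 3.10 (proof, Step 1)] -/
theorem noMasterModeIn_zero_omega_zero {M a Λ : ℝ} (hsub : IsSubextremal M a Λ) (ha : a ≠ 0)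
    (μ : ℝ) : NoMasterModeIn M a Λ 0 μ {q | q.1 = 0 ∧ q.2 ≠ 0} := by
  rintro ω m ⟨hω, hm⟩ _ hmode
  dsimp only at hω hm
  subst hω
  exact not_hasMasterMode_zero_omega_zero hsub ha hm hmode

/-- **The closed real axis for `m ≠ 0` rotating scalars**: combining `noMasterModeIn_zero_realAxis`
(`ω ∈ ℝ ∖ {0}` outside the superradiant interval) with the zero frequency: for `a ≠ 0` there is no
`s = 0` master mode with `Im ω = 0`, `m ≠ 0` and `(Re ω − mϖ₁)(Re ω − mϖ₂) ≥ 0` — `ω = 0` included.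
[cite: CasalsTeixeiradacosta2022, Theorem 3.10 (proof, Step 1)] -/
theorem noMasterModeIn_zero_realAxis_of_m_ne_zero {M a Λ : ℝ} (hsub : IsSubextremal M a Λ)
    (ha : a ≠ 0) (μ : ℝ) :
    NoMasterModeIn M a Λ 0 μ
      {q | q.1.im = 0 ∧ q.2 ≠ 0 ∧ 0 ≤ (q.1.re - q.2 * horizonAngVel a (rPlus M a Λ)) *
        (q.1.re - q.2 * horizonAngVel a (rCosmo M a Λ))} := by
  rintro ω m ⟨hω, hm, hSR⟩ _ hmode
  dsimp only at hω hm hSR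
  obtain ⟨lamBar, R, hang, hR, hin, hout, hnt⟩ := hmode
  have hν : ((a : ℂ) * ω).im = 0 := by
    rw [mul_im, ofReal_re, ofReal_im, hω]; ring
  have hlam : lamBar.im = 0 := masterAngularEigenvalue_real hν hang
  obtain ⟨r, hr, hne⟩ := hnt
  exact hne (masterRadial_zero_real_eq_zero hsub hω hlam (Or.inr (mul_ne_zero ha hm)) hSR hR hin
    hout r hr)

/-- Teukolsky form (`μ = 1`): no `s = 0` mode `HasMode M a Λ 0 0 m` at `ω = 0` for `a ≠ 0`, `m ≠ 0`.
[cite: CasalsTeixeiradacosta2022, Theorem 3.10 (proof, Step 1)] -/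
theorem not_hasMode_zero_omega_zero {M a Λ : ℝ} {m : ℝ} (hsub : IsSubextremal M a Λ) (ha : a ≠ 0)
    (hm : m ≠ 0) : ¬HasMode M a Λ 0 0 m := by
  rw [← hasMasterMode_one_iff M a Λ 0 hsub.2.1.le]
  exact not_hasMasterMode_zero_omega_zero hsub ha hm

end Literature.Geometry.Lorentzian.KerrDeSitter

end
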